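import Summits.FinalStateConjecture.FinalStateConjecture.Theses.PhaseMixingCapture
import Literature.Geometry.Lorentzian.StabilityCauchy
import Literature.Geometry.Lorentzian.CauchyProblemMGHDExistence
import Literature.Geometry.Lorentzian.LeviCivitaProofs
import Literature.Geometry.Lorentzian.KerrDataSchwarzschildConstraints
import Literature.Geometry.Lorentzian.KerrSliceFacts
import Literature.Barriers.FinalStateConjecture.SlowlyRotatingKerrFrontier
import Summits.FinalStateConjecture.FinalStateConjecture.Theorems.NearExtremalKappaCapture.Negative.ExponentMonotonicity

/-!
# Disproof of `BulkKerrCapture` — findings (crux `stmt-FinalStateConjecture-10696`,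
route `PhaseMixingCapture`, rank 4; standing disprover `cdisprove`, cycles 1–3, 2026-08-16)

**Verdict after cycle 3 (gen-3 seat): NO KILL — targets analysed.** New: §6 (the four registered
stubs S1–S4 of the picked line `frozen-charge-flat-modulus`, skeleton `294962749d2a`, restated
verbatim and attacked: S4 `SpinReflection` is TRUE for the tree's Kerr–Schild definitions — not a
target; S2 `FarCompleteNullInfinity` is IMPLIED BY THE CRUX (`farCompleteNullInfinity_of_
bulkKerrCapture`); S1 `LocalKerrConvergence` is implied by the crux up to its upgrade `∃ k ↦ ∀ k`
(`localKerrConvergence_exists_k_of_bulkKerrCapture`); S3 `LipschitzFinalState` at the centre of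
its ball IS Kerr-limit rigidity (`lipschitzFinalState_atKerrData`, kill template
`not_lipschitzFinalState_of_wrongLimit`; an unprinted near-isometry rigidity statement needing
`k₀ ≥ 3`, not `2`), and its absolute values are LOAD-BEARING: the sign-sensitive universal
modulus is refuted at every rotating centre from S4 + one convergent MGHD
(`lipschitzFinalStateSigned_false_of_convergent_mghd`; from S1 + CBG + constraints:
`lipschitzFinalStateSigned_false`)); §7 (BOTH instance classes are now tree theorems —
`Kerr.sliceFacts_holds`, `kerrFacts` — so the crux equals its body at the canonical instances,
`bulkKerrCapture_iff_body`, and every negative lemma of §3/§3b holds modulo Choquet-Bruhat–Geroch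
(+ constraints for (A)) ALONE: `not_nonnegMass_family`, `not_closedRange_family`,
`not_bulkKerrCapture_of_schwarzschild_mghd'`). Why the crux still resists: every refutation needs
ONE maximal vacuum Cauchy development whose conclusion fails; CBG is unconstructible here and no
bad development of near-Kerr data is expected to exist (Hintz arXiv:2606.28253 Thm 13.1 claims the
full sub-extremal range; no sub-extremal instability mechanism is known); the uniformity of
`(ε, C)` on compact spin sets cannot fail by ball overlap (balls around different spins are
mutually at infinite `H^s_δ`-distance for `δ ≥ 1/2` — frozen angular momentum — so uniformity is
purely a statement about the continuity of the theorem's constants in `a`, Hintz Rem 13.2).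

**Verdict after cycle 2: NO KILL** — and a proof that no kill can come from the quantifier
prefix: modulo the named facts, the two-parameter family of the crux is completely classified
(`bulkCaptureFamily_classification`, §3b): vacuous / implied by the crux / false, with the crux
the envelope of the non-refuted members. New in cycle 2 (gen-2 seat): §3b (degenerate centres in
one lemma, Levi-Civita hypothesis DISCHARGED via `PseudoRiemannianMetric.hasLeviCivita`,
classification), §3c (two natural strengthenings EXPECTED false — uniform-to-extremality (third
law, Kehle–Unger) and frozen low regularity `s ≤ 1` (two-body escape) — each proved to imply the
crux, neither refutable without non-Kerr data), §5 (second junk audit: `IsMaximal`,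
`IsCauchyHypersurface`, `IsNormalisedNullRayFrom`, `sojournTime`, `ConvergesTo`,
`dataWeightedSobolevEDist` all honest; load-bearing `s ≥ 2` and `r₀ ≤ r₊`; the vendoring gap to
Hintz arXiv:2606.28253 Thm. 13.1 — `H_b^∞` polyhomogeneous data vs the crux's finite-`s` ball —
and the exact wording of his Rem. 13.2 on base-point locality).

**Cycle-1 summary (kept verbatim below): NO KILL.** The crux is the consequence-form Kerr-stability statement on the
compact spin sets `|a| ≤ a₁ M` (`a₁ < 1`) at the fixed horizon-penetrating slice `r₀ = M`, with
`(ε, C)` uniform in `a`. It resists every cheap attack because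

* (centre) at the centre of the data ball (`D = Kerr.data M a M`, distance `0`) the conclusion is
  forced to `(M', a') = (M, a)` (`captureAt_atKerrData`) and is then the TRUE sanity statement
  "every MGHD of exact Kerr data on `{t* = 0, r > M}` is far-complete and converges to `g_{M,a}`"
  (outgoing rays complete; an infalling far ray of origin radius `R` ends on the Cauchy horizon of
  the artificial inner edge `{r = M}` — at `r = r₋`, resp. `r = 0` for `a = 0` — only after affine
  time `≳ R`, entering `J⁺(ι B₀)` after `≈ (R − R₀)/2`, so its sojourn is `≳ (R + R₀)/2 → ∞`;
  the exterior `{t* ≥ 0, r ≥ r₊}` lies in `D⁺` of the slice, so the identity chart is a late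
  embedding with deviation `0`). No junk falsity at the centre.
* (junk audit, all negative) `IsNormalisedNullRayFrom` demands a MAXIMAL geodesic (short segments
  excluded); geodesic/`leviCivitaFun` junk could only make the far clause weaker, never false;
  `HasLeviCivita` is a `Fact` (`Prop`), so `∀ [𝒟.metric.HasLeviCivita]` hides no data; `𝒟oc` is
  existential, so the covering clause of `IsLateEmbedding` is dischargeable with
  `𝒟oc := Ψ '' lateRegion` (a WEAKNESS for the planner, not a falsity); `k` existential (`k = 0`:
  plain sup-norm convergence on the slabs `{t* = τ}` suffices, so no peeling / derivative-loss /
  non-smooth-𝓘⁺ barrier bites); `(s, δ)` existential and the ball SHRINKS as `s, δ` grow, so the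
  prover may take structureless fast-decaying perturbations (Hintz's case `E₀ = ∅`);
  `dataWeightedSobolevEDist_self = 0` so `ε > 0` cannot make the hypotheses vacuous;
  `Kerr.Facts` / `Kerr.SliceFacts` fields re-read one by one (connectedness of `{r > m}`,
  analyticity of `η + 2Hℓ⊗ℓ` and of `V` on `{r > 0}`, pullback smoothness, Koszul covariant
  derivative, spacelikeness for `M ≥ 0`, symmetry/smoothness of `k`): all true in print ⇒ no
  trivial-truth route through an inconsistent instance either.
* (physics) no nonlinear instability of a sub-extremal Kerr exterior is known or conjectured; the
  full sub-extremal range is claimed in preprint (Hintz, arXiv:2606.28253, Thm. 1.1 / 13.1, see the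
  grounder note on the item and `Literature.Barriers.FinalStateConjecture.KerrStabilityHoldsBelowNarrow`);
  the catalogued instabilities (`ExtremalHorizonInstability` = Aretakis at `|a| = M`,
  `KleinGordonSuperradiantInstability` / `KerrLinearHair` / `HairyKerrBifurcation` = MASSIVE fields,
  `GregoryLaflammeInstability` = black strings, `NakedSingularityInstability`) do not touch vacuum
  sub-extremal Kerr in `3 + 1` dimensions.

**Why no UNCONDITIONAL `¬` can be landed from this side (obstruction, recorded for the lead).**
`BulkKerrCapture` is `∀ [Kerr.Facts] [Kerr.SliceFacts], …`; any refutation must CONSTRUCT both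
instances AND a maximal vacuum Cauchy development of some near-Kerr datum VIOLATING the conclusion.
Cycle-2 update on the cost of the instances: `Kerr.Facts` is now a tree THEOREM
(`SwallowTheDatum.kerrFacts`), and `Kerr.SliceFacts` reduces to its two unproved fields
`Kerr.sliceK_symm`, `Kerr.contMDiff_sliceK` (`sliceFacts_of` in the sister file
`NearExtremalKappaCapture/Negative/ExponentMonotonicity.lean`); `hLC` is a theorem
(`PseudoRiemannianMetric.hasLeviCivita`) and the `a = 0` constraints are a theorem
(`Kerr.data_isVacuumConstraintSolution_zero`). What remains unconstructible is the decisive part: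
an MGHD (Choquet-Bruhat–Geroch, `choquetBruhat_geroch_exists_mghd_cauchy`) of a ball datum whose
conclusion FAILS — and at the only nameable data (exact Kerr) the conclusion holds on paper. Every
negative statement below is therefore a NEGATIVE LEMMA MODULO named facts, never a `refuted-…`
verdict.

## Contents

* §1 `CaptureAt` — the conclusion block with its parameters exposed; `bulkKerrCapture_iff`
  (the crux ↔ its `CaptureAt` form; certifies that the inlined sojourn clause IS
  `DataEmbedding.HasCompleteFutureNullInfinityFar`).
* §2 structure the prover can use: `no_spin_of_neg` (`a₁ < 0` ⇒ empty spin range),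
  `isSubextremal_of_spin_le`, `bulkKerrCapture_iff_nonneg` (WLOG `0 ≤ a₁`),
  `captureAt_atKerrData` / `bulkKerrCapture_atKerrData` (centre of the ball pins `(M', a')`),
  `bulkKerrCapture_pointwise` / `captureAt_of_kerrStabilityHoldsBelowNarrow_one` (the crux sits
  between the barrier family's strongest instance `KerrStabilityHoldsBelowNarrow 1` taken pointwise
  at `r₀ = M` and itself: the only extra content is UNIFORMITY of `(ε, C)` on compact spin sets).
* §3 LOAD-BEARING ANALYSIS (negative lemmas modulo named facts): the crux is the member
  `T = Iio 1`, `P = (0 < ·)` of the parametrised family `BulkCaptureFamily T P`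
  (`bulkKerrCapture_iff_family`); `bulkCaptureFamily_false_without_spinGap` — the closed-range
  member `T = Iic 1` (`a₁ ≤ 1`) is FALSE already at exact extremal Kerr data (`a = M`: the modulus
  pins `a' = a = M = M'`, contradicting `IsSubextremal M' a'`);
  `bulkCaptureFamily_false_without_posMass` — the member `P = ⊤` (`0 ≤ M`) is FALSE at the flat
  punctured data `Kerr.data 0 0 0` (`M' = 0` pinned, `|a'| < 0`). So any proof must use BOTH the
  strict spin gap and `0 < M`, and it uses them already at the centre of the ball. (First landing
  attempt p72865/p72866 stated the two members as closed `def … : Prop` and was relocated by the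
  gate to `Literature/Uncategorized/` as if they were named facts; this parametrised form is the
  intended one.)
* §2a (cycle 2) `captureAt_atKerrData'`, `bulkKerrCapture_atKerrData'` (centre without `hLC`),
  `bulkKerrCapture_atSchwarzschildData` (the crux's prediction at the Schwarzschild centre with NO
  named-fact hypothesis), `not_bulkKerrCapture_of_schwarzschild_mghd` (kill template: one bad
  Schwarzschild MGHD refutes the crux outright).
* §2b (cycle 2) `CaptureAt.mono` (up-set in `(s, δ)`, down-set in `k`, antitone in `ε`, monotone in
  `C ≥ 0`; uses the sister file's `dataWeightedSobolevEDist_mono`), `bulkKerrCapture_iff_normalForm`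
  (WLOG `s ≥ s₀`, `δ ≥ δ₀`, `k = 0`, `ε ≤ 1`, `C ≥ 0` — the crux IS its high-regularity member),
  `bulkKerrCapture_iff_diagonal` (`s = δ = N`, `k = 0`), `not_bulkKerrCapture_iff` (a kill must
  defeat every `N`).
* §3b (cycle 2) `captureAt_noMGHD_of_not_isSubextremal` (every degenerate centre — extremal,
  super-extremal, massless — in one lemma, no `hLC`), `exists_mghd_kerrData_of` /
  `exists_mghd_kerrData_zero` (the `a = 0` constraints are the tree theorem
  `Kerr.data_isVacuumConstraintSolution_zero`, so the massless kill is now modulo CBG ALONE),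
  `bulkCaptureFamily_false_of_one_le` / `_of_mass_zero` (general `(T, P)` forms of the cycle-1
  kills), `bulkCaptureFamily_of_bulkKerrCapture`, `bulkCaptureFamily_of_vacuous`,
  `bulkCaptureFamily_classification` (vacuous ∨ implied-by-crux ∨ false — the crux is the
  envelope).
* §3c (cycle 2) `UniformToExtremalityCapture`, `LowRegularityCapture`: strengthenings expected
  false (third law / two-body escape), each `→ BulkKerrCapture`; signposts, not refutations.
* §4 strengthenings known false in print / in the tree (prose): all-origin completeness
  (`HasCompleteFutureNullInfinity` from the whole slice) fails for EVERY development of data on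
  `Kerr.slice a r₀` (inner-edge rays; `ModelData`, note before `kerr_hasCompleteFutureNullInfinity`;
  `StabilityCauchy`, docstring of `HasCompleteFutureNullInfinityFar`) — the far-origin restriction
  is load-bearing; `(ε, C)` uniform in `M` is excluded by scaling (not formalisable without
  non-Kerr developments); `C · dist` instead of `C · √dist` is unprinted (KS (3.4.7)–(3.4.8)).
* §5 (cycle 2, prose) second junk audit; load-bearing `s ≥ 2`, `r₀ ≤ r₊`; the Hintz 13.1 data-class
  gap and Rem. 13.2; what is not attackable from this side and why.
* §6 (cycle 3) TARGETS = the registered stubs of line `frozen-charge-flat-modulus`: S1–S4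
  restated verbatim (`LocalKerrConvergence`, `FarCompleteNullInfinity`, `LipschitzFinalState`,
  `SpinReflection`); `spin_le_of_window`; `farCompleteNullInfinity_of_bulkKerrCapture` (crux ⇒
  S2); `localKerrConvergence_exists_k_of_bulkKerrCapture` (crux ⇒ S1 with `∃ k`);
  `KerrLimitRigidity`, `lipschitzFinalState_atKerrData` / `_atSchwarzschildData` (S3 at the
  centre), `not_lipschitzFinalState_of_wrongLimit` (kill template); `LipschitzFinalStateSigned`,
  `lipschitzFinalStateSigned_atKerrData`, `lipschitzFinalStateSigned_false_of_convergent_mghd`,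
  `lipschitzFinalStateSigned_false` (the absolute values of S3 are load-bearing).
* §7 (cycle 3) instance-free forms: `kerrFacts`, `bulkKerrCapture_iff_body`,
  `not_nonnegMass_family` (CBG alone), `not_closedRange_family`,
  `not_bulkKerrCapture_of_schwarzschild_mghd'`.
* `-- Targets`: §6 (payload `targets = []`, `stuck_stubs = []` at cycle 3; the skeleton's four
  stubs are attacked pre-emptively; S4 true, S1/S2 necessary, S3 analysed — none broken).

LANDED through the gate (importable by ideators / planners / the lead; cycle 2 adds
`…/Negative/DegenerateCentres.lean` with §3b — see NOTES of the gen-2 seat for its p-id):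
`Summits/FinalStateConjecture/FinalStateConjecture/Theorems/BulkKerrCapture/Negative/SpinGapAndMass.lean`
(p73266, commit 2092fe9f93d1: §1–§3 of this file — `CaptureAt`, `bulkKerrCapture_iff`, the centre-of-ball
lemmas, `BulkCaptureFamily`, `bulkCaptureFamily_false_without_spinGap/posMass`, `strengthenings_fail`)
and `…/Negative/PointwiseVsUniform.lean` (p73746, commit d060988edc85: `bulkKerrCapture_pointwise`,
`mem_Ioo_rMinus_rPlus`, `captureAt_of_kerrStabilityHoldsBelowNarrow_one`), namespace
`Summit.FinalStateConjecture.FinalStateConjecture.Theorems.BulkKerrCapture.Negative`. This workfile keeps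
its own copies (namespace `…Cruxes.BulkKerrCapture.Disproof`) so that it elaborates stand-alone.
-/

noncomputable section

-- the crux-workfile namespace prescribed by the cdisprove protocol repeats the summit name
set_option linter.dupNamespace false

open Set
open scoped Manifold ENNReal ContDiff

namespace Summit.FinalStateConjecture.FinalStateConjecture.Cruxes.BulkKerrCapture.Disproof

open Literature.Geometry.Lorentzian
open Summit.FinalStateConjecture.FinalStateConjecture.Theses.PhaseMixingCapture (BulkKerrCapture)

/-! ## §1 The conclusion block with parameters exposed -/

/-- `CaptureAt s δ k M hM ε C a`: every vacuum-constraint solution `D` on `Kerr.slice a M` within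
`H^s_δ`-distance `ε` of `Kerr.data M a M` has all its maximal vacuum Cauchy developments
far-complete (`DataEmbedding.HasCompleteFutureNullInfinityFar`), with a region converging in `Cᵏ`
to a sub-extremal `g_{M',a'}` and `|M' − M| + |a' − a| ≤ C √dist`. This is the matrix of the crux
(and of `Literature.Barriers.FinalStateConjecture.KerrStabilityHoldsBelowNarrow` at `r₀ = M`).
[folklore] -/
def CaptureAt [Kerr.Facts] [Kerr.SliceFacts] (s : ℕ) (δ : ℝ) (k : ℕ) (M : ℝ) (hM : 0 ≤ M)
    (ε C a : ℝ) : Prop :=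
  ∀ (D : InitialDataSet 𝓘(ℝ, E3) (Kerr.slice a M)) [D.metric.HasLeviCivita],
    D.IsVacuumConstraintSolution →
    InitialDataSet.dataWeightedSobolevEDist s δ D (Kerr.data M a M hM) < ENNReal.ofReal ε →
    ∀ 𝒟 : VacuumCauchyDevelopment D, 𝒟.IsMaximal →
      ∃ (M' a' : ℝ) (𝒟oc : Set 𝒟.carrier), Kerr.IsSubextremal M' a' ∧
        𝒟.HasCompleteFutureNullInfinityFar ∧
        𝒟.toSpacetime.ConvergesToKerr 𝒟oc M' a' k ∧
        |M' - M| + |a' - a| ≤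
          C * √(InitialDataSet.dataWeightedSobolevEDist s δ D (Kerr.data M a M hM)).toReal

/-- The closed far region of the slice, as a subset of the slice, is `{q | R + 1 ≤ ‖q‖}`
(`R = Kerr.afRadius a r₀`). [folklore] -/
theorem range_farSliceIncl (a r₀ : ℝ) :
    range (Kerr.farSliceIncl a r₀) = {q : Kerr.slice a r₀ | Kerr.afRadius a r₀ + 1 ≤ ‖(q : E3)‖} := by
  ext q
  constructor
  · rintro ⟨y, rfl⟩
    exact y.2
  · intro hq
    exact ⟨⟨(q : E3), hq⟩, Subtype.ext rfl⟩

/-- **The crux in `CaptureAt` form.** The inlined sojourn clause of the route decl is, after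
`range_farSliceIncl`, literally `DataEmbedding.HasCompleteFutureNullInfinityFar` (this re-certifies
the planner's `bulk_iff`). [folklore] -/
theorem bulkKerrCapture_iff :
    BulkKerrCapture ↔
      ∀ [Kerr.Facts] [Kerr.SliceFacts], ∀ a₁ : ℝ, a₁ < 1 → ∃ (s : ℕ) (δ : ℝ) (k : ℕ),
        ∀ (M : ℝ) (hM : 0 < M), ∃ ε > (0 : ℝ), ∃ C : ℝ, ∀ a : ℝ, |a| ≤ a₁ * M →
          CaptureAt s δ k M hM.le ε C a := by
  simp only [BulkKerrCapture, CaptureAt, DataEmbedding.HasCompleteFutureNullInfinityFar,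
    DataEmbedding.HasCompleteFutureNullInfinityFrom, range_farSliceIncl]

/-! ## §2 Structure of the quantifier prefix (prover-usable) -/

/-- For `a₁ < 0` the spin range `|a| ≤ a₁ M` (`M > 0`) is EMPTY: the crux is only about
`a₁ ∈ [0, 1)`. [folklore] -/
theorem no_spin_of_neg {a₁ M a : ℝ} (ha₁ : a₁ < 0) (hM : 0 < M) : ¬ |a| ≤ a₁ * M := by
  intro h
  have : a₁ * M < 0 := mul_neg_of_neg_of_pos ha₁ hM
  linarith [abs_nonneg a]

/-- Every spin in the range is sub-extremal: `|a| ≤ a₁ M < M`. [folklore] -/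
theorem isSubextremal_of_spin_le {a₁ M a : ℝ} (ha₁ : a₁ < 1) (hM : 0 < M) (h : |a| ≤ a₁ * M) :
    Kerr.IsSubextremal M a := by
  unfold Kerr.IsSubextremal
  have : a₁ * M < 1 * M := mul_lt_mul_of_pos_right ha₁ hM
  linarith

/-- WLOG `0 ≤ a₁`: the crux is equivalent to its restriction to `a₁ ∈ [0, 1)` (for `a₁ < 0` take
the witnesses `(0, 0, 0, 1, 0)`; the spin hypothesis is then unsatisfiable). [folklore] -/
theorem bulkKerrCapture_iff_nonneg :
    BulkKerrCapture ↔
      ∀ [Kerr.Facts] [Kerr.SliceFacts], ∀ a₁ : ℝ, 0 ≤ a₁ → a₁ < 1 → ∃ (s : ℕ) (δ : ℝ) (k : ℕ),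
        ∀ (M : ℝ) (hM : 0 < M), ∃ ε > (0 : ℝ), ∃ C : ℝ, ∀ a : ℝ, |a| ≤ a₁ * M →
          CaptureAt s δ k M hM.le ε C a := by
  rw [bulkKerrCapture_iff]
  constructor
  · intro h _ _ a₁ _ ha₁
    exact h a₁ ha₁
  · intro h _ _ a₁ ha₁
    rcases le_or_gt 0 a₁ with h0 | h0
    · exact h a₁ h0 ha₁
    · exact ⟨0, 0, 0, fun M hM ↦ ⟨1, one_pos, 0, fun a ha ↦ (no_spin_of_neg h0 hM ha).elim⟩⟩

/-- **Centre of the ball.** `CaptureAt … a` applied to the exact Kerr data (distance `0`) pins the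
final parameters to `(M, a)` and yields: every MGHD of `Kerr.data M a M` is far-complete and has a
region converging in `Cᵏ` to `g_{M,a}` itself. The two named facts about the Kerr data enter as
hypotheses (`hLC`: Levi-Civita of `h`; `hvac`: the vacuum constraints), exactly as in
`klainerman_szeftel_kerr_stability_small_a_cauchy.atKerrData`. This is the cheapest necessary
condition of the crux; it is the expected-true sanity statement (module docstring, "centre"),
so it offers no refutation. [folklore] -/
theorem captureAt_atKerrData [Kerr.Facts] [Kerr.SliceFacts] {s : ℕ} {δ : ℝ} {k : ℕ} {M : ℝ}
    {hM : 0 ≤ M} {ε C a : ℝ} (hε : 0 < ε) (h : CaptureAt s δ k M hM ε C a)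
    (hLC : (Kerr.data M a M hM).metric.isCovariantDerivativeOn_leviCivitaFun)
    (hvac : Kerr.data_isVacuumConstraintSolution M a M)
    (𝒟 : VacuumCauchyDevelopment (Kerr.data M a M hM)) (hmax : 𝒟.IsMaximal) :
    𝒟.HasCompleteFutureNullInfinityFar ∧
      ∃ 𝒟oc : Set 𝒟.carrier, 𝒟.toSpacetime.ConvergesToKerr 𝒟oc M a k := by
  haveI := PseudoRiemannianMetric.HasLeviCivita.of _ hLC
  have h0 : InitialDataSet.dataWeightedSobolevEDist s δ (Kerr.data M a M hM)
      (Kerr.data M a M hM) < ENNReal.ofReal ε := by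
    rw [InitialDataSet.dataWeightedSobolevEDist_self]
    exact ENNReal.ofReal_pos.2 hε
  obtain ⟨M', a', 𝒟oc, -, hnull, hconv, hpar⟩ := h _ (hvac hM) h0 𝒟 hmax
  rw [InitialDataSet.dataWeightedSobolevEDist_self, ENNReal.toReal_zero, Real.sqrt_zero,
    mul_zero] at hpar
  have hM' : M' = M := by
    refine sub_eq_zero.1 (abs_eq_zero.1 (le_antisymm ?_ (abs_nonneg _)))
    linarith [abs_nonneg (a' - a)]
  have ha' : a' = a := by
    refine sub_eq_zero.1 (abs_eq_zero.1 (le_antisymm ?_ (abs_nonneg _)))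
    linarith [abs_nonneg (M' - M)]
  subst hM' ha'
  exact ⟨hnull, 𝒟oc, hconv⟩

/-- **The crux at the centre of its ball**: `BulkKerrCapture` implies that for every `M > 0` and
every sub-extremal spin `|a| < M` (take `a₁ := |a|/M`) every MGHD of the exact Kerr data on
`{t* = 0, r > M}` is far-complete and converges in some `Cᵏ` to `g_{M,a}`. [folklore] -/
theorem bulkKerrCapture_atKerrData (h : BulkKerrCapture) [Kerr.Facts] [Kerr.SliceFacts]
    (hLC : ∀ (M a r₀ : ℝ) (hM : 0 ≤ M),
      (Kerr.data M a r₀ hM).metric.isCovariantDerivativeOn_leviCivitaFun)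
    (hvac : ∀ (M a r₀ : ℝ), Kerr.data_isVacuumConstraintSolution M a r₀)
    {M a : ℝ} (hM : 0 < M) (ha : Kerr.IsSubextremal M a) :
    ∃ k : ℕ, ∀ 𝒟 : VacuumCauchyDevelopment (Kerr.data M a M hM.le), 𝒟.IsMaximal →
      𝒟.HasCompleteFutureNullInfinityFar ∧
        ∃ 𝒟oc : Set 𝒟.carrier, 𝒟.toSpacetime.ConvergesToKerr 𝒟oc M a k := by
  rw [bulkKerrCapture_iff] at h
  have ha₁ : |a| / M < 1 := by
    rw [div_lt_one hM]
    exact ha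
  obtain ⟨s, δ, k, hk⟩ := h (|a| / M) ha₁
  obtain ⟨ε, hε, C, hC⟩ := hk M hM
  have hspin : |a| ≤ |a| / M * M := by rw [div_mul_cancel₀ _ hM.ne']
  exact ⟨k, fun 𝒟 hmax ↦ captureAt_atKerrData hε (hC a hspin) (hLC M a M hM.le) (hvac M a M) 𝒟 hmax⟩

/-- **Pointwise content of the crux at a single spin.** For every `M > 0` and `|a| < M` the crux
yields exponents, a ball and a constant for that one spin (take `a₁ := |a|/M`). [folklore] -/
theorem bulkKerrCapture_pointwise (h : BulkKerrCapture) [Kerr.Facts] [Kerr.SliceFacts] {M a : ℝ}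
    (hM : 0 < M) (ha : Kerr.IsSubextremal M a) :
    ∃ (s : ℕ) (δ : ℝ) (k : ℕ), ∃ ε > (0 : ℝ), ∃ C : ℝ, CaptureAt s δ k M hM.le ε C a := by
  rw [bulkKerrCapture_iff] at h
  have ha₁ : |a| / M < 1 := by
    rw [div_lt_one hM]
    exact ha
  obtain ⟨s, δ, k, hk⟩ := h (|a| / M) ha₁
  obtain ⟨ε, hε, C, hC⟩ := hk M hM
  have hspin : |a| ≤ |a| / M * M := by rw [div_mul_cancel₀ _ hM.ne']
  exact ⟨s, δ, k, ε, hε, C, hC a hspin⟩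

/-- The fixed slice position `r₀ = M` lies strictly between the horizons for every sub-extremal
spin: `r₋ = M − √(M² − a²) < M < M + √(M² − a²) = r₊` (`|a| < M` alone; no separate `0 < M`
needed). [folklore] -/
theorem mem_Ioo_rMinus_rPlus {M a : ℝ} (ha : Kerr.IsSubextremal M a) :
    M ∈ Ioo (Kerr.rMinus M a) (Kerr.rPlus M a) := by
  unfold Kerr.IsSubextremal at ha
  have hsq : 0 < M ^ 2 - a ^ 2 := by
    have h1 : |a| ^ 2 < M ^ 2 := by
      exact pow_lt_pow_left₀ ha (abs_nonneg a) two_ne_zero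
    rw [sq_abs] at h1
    linarith
  have hpos : 0 < √(M ^ 2 - a ^ 2) := Real.sqrt_pos.2 hsq
  simp only [Kerr.rMinus, Kerr.rPlus, mem_Ioo]
  constructor <;> linarith

/-- **The barrier family's strongest instance gives the crux POINTWISE in the spin, at the crux's
slice `r₀ = M`.** `Literature.Barriers.FinalStateConjecture.KerrStabilityHoldsBelowNarrow 1` (all
`|a| < M`, every `r₀ ∈ (r₋, r₊)`; claimed in preprint by Hintz, arXiv:2606.28253, Thm. 1.1 / 13.1,
see that barrier's block) yields `CaptureAt s δ k M _ ε C a` for each single sub-extremal spin,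
with `(s, δ, k)` global but `(ε, C)` depending on `(M, a)`. What the crux adds on top is exactly
the UNIFORMITY of `(ε, C)` on the compact spin sets `|a| ≤ a₁ M` — not printed anywhere (grounder
note on the item), plausible by continuity of the constants in `a`, and the only part of the crux a
prover must supply beyond vendoring the full-range theorem. Neither statement formally implies
the other (the crux fixes `r₀ = M`; the barrier instance is pointwise in `a`). [folklore] -/
theorem captureAt_of_kerrStabilityHoldsBelowNarrow_one [Kerr.Facts] [Kerr.SliceFacts]
    (h : Literature.Barriers.FinalStateConjecture.KerrStabilityHoldsBelowNarrow 1) :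
    ∃ (s : ℕ) (δ : ℝ) (k : ℕ), ∀ {M a : ℝ} (hM : 0 < M), Kerr.IsSubextremal M a →
      ∃ ε > (0 : ℝ), ∃ C : ℝ, CaptureAt s δ k M hM.le ε C a := by
  obtain ⟨s, δ, k, hk⟩ := h
  refine ⟨s, δ, k, fun {M a} hM ha ↦ ?_⟩
  have ha' : |a| < 1 * M := by
    rw [one_mul]
    exact ha
  obtain ⟨ε, hε, C, hC⟩ := hk M a hM ha' M (mem_Ioo_rMinus_rPlus ha)
  exact ⟨ε, hε, C, hC⟩

/-! ## §2a The centre without named-fact hypotheses (cycle 2)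

With `hLC` a theorem and the `a = 0` constraints a theorem, the centre-of-ball lemma specialises
to a prediction of the crux that carries NO named-fact hypothesis: every MGHD of the Schwarzschild
Kerr–Schild slice datum `Kerr.data M 0 M` is far-complete and `Cᵏ`-converges to `g_{M,0}`
(`bulkKerrCapture_atSchwarzschildData`); contrapositively ONE bad Schwarzschild MGHD kills the
crux outright (`not_bulkKerrCapture_of_schwarzschild_mghd`) — the exact shape of the only
unconditional kill available on this side, expected impossible (module docstring, "centre").
Landed as `…/Negative/SchwarzschildCentre.lean`. -/

/-- Centre of the ball with the Levi-Civita hypothesis discharged. [folklore] -/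
theorem captureAt_atKerrData' [Kerr.Facts] [Kerr.SliceFacts] {s : ℕ} {δ : ℝ} {k : ℕ} {M : ℝ}
    {hM : 0 ≤ M} {ε C a : ℝ} (hε : 0 < ε) (h : CaptureAt s δ k M hM ε C a)
    (hvac : Kerr.data_isVacuumConstraintSolution M a M)
    (𝒟 : VacuumCauchyDevelopment (Kerr.data M a M hM)) (hmax : 𝒟.IsMaximal) :
    𝒟.HasCompleteFutureNullInfinityFar ∧
      ∃ 𝒟oc : Set 𝒟.carrier, 𝒟.toSpacetime.ConvergesToKerr 𝒟oc M a k := by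
  haveI := (Kerr.data M a M hM).metric.hasLeviCivita
  have h0 : InitialDataSet.dataWeightedSobolevEDist s δ (Kerr.data M a M hM)
      (Kerr.data M a M hM) < ENNReal.ofReal ε := by
    rw [InitialDataSet.dataWeightedSobolevEDist_self]
    exact ENNReal.ofReal_pos.2 hε
  obtain ⟨M', a', 𝒟oc, -, hnull, hconv, hpar⟩ := h _ (hvac hM) h0 𝒟 hmax
  rw [InitialDataSet.dataWeightedSobolevEDist_self, ENNReal.toReal_zero, Real.sqrt_zero,
    mul_zero] at hpar
  have h1 : |M' - M| ≤ 0 := by linarith [abs_nonneg (a' - a)]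
  have h2 : |a' - a| ≤ 0 := by linarith [abs_nonneg (M' - M)]
  have hM' : M' = M := by linarith [abs_le.1 h1]
  have ha' : a' = a := by linarith [abs_le.1 h2]
  subst hM' ha'
  exact ⟨hnull, 𝒟oc, hconv⟩

/-- The crux at a sub-extremal centre, modulo the constraint fact at that spin only. [folklore] -/
theorem bulkKerrCapture_atKerrData' (h : BulkKerrCapture) [Kerr.Facts] [Kerr.SliceFacts]
    {M a : ℝ} (hM : 0 < M) (ha : Kerr.IsSubextremal M a)
    (hvac : Kerr.data_isVacuumConstraintSolution M a M) :
    ∃ k : ℕ, ∀ 𝒟 : VacuumCauchyDevelopment (Kerr.data M a M hM.le), 𝒟.IsMaximal →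
      𝒟.HasCompleteFutureNullInfinityFar ∧
        ∃ 𝒟oc : Set 𝒟.carrier, 𝒟.toSpacetime.ConvergesToKerr 𝒟oc M a k := by
  rw [bulkKerrCapture_iff] at h
  have ha₁ : |a| / M < 1 := by
    rw [div_lt_one hM]
    exact ha
  obtain ⟨s, δ, k, hk⟩ := h (|a| / M) ha₁
  obtain ⟨ε, hε, C, hC⟩ := hk M hM
  have hspin : |a| ≤ |a| / M * M := by rw [div_mul_cancel₀ _ hM.ne']
  exact ⟨k, fun 𝒟 hmax ↦ captureAt_atKerrData' hε (hC a hspin) hvac 𝒟 hmax⟩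

/-- **The crux's prediction at the Schwarzschild centre — no named-fact hypothesis left.**
[folklore] -/
theorem bulkKerrCapture_atSchwarzschildData (h : BulkKerrCapture) [Kerr.Facts] [Kerr.SliceFacts]
    {M : ℝ} (hM : 0 < M) :
    ∃ k : ℕ, ∀ 𝒟 : VacuumCauchyDevelopment (Kerr.data M 0 M hM.le), 𝒟.IsMaximal →
      𝒟.HasCompleteFutureNullInfinityFar ∧
        ∃ 𝒟oc : Set 𝒟.carrier, 𝒟.toSpacetime.ConvergesToKerr 𝒟oc M 0 k :=
  bulkKerrCapture_atKerrData' h hM (by unfold Kerr.IsSubextremal; simpa using hM)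
    (Kerr.data_isVacuumConstraintSolution_zero M M)

/-- **Kill template** (contrapositive): ONE maximal vacuum Cauchy development of ONE Schwarzschild
slice datum `Kerr.data M 0 M` that is not far-complete, or admits no `Cᵏ`-converging late
Kerr–Schild chart for any `k`, refutes the crux outright given the two instance facts. Expected
impossible (the centre analysis), recorded as the precise residual obligation. [folklore] -/
theorem not_bulkKerrCapture_of_schwarzschild_mghd [Kerr.Facts] [Kerr.SliceFacts] {M : ℝ}
    (hM : 0 < M) (𝒟 : VacuumCauchyDevelopment (Kerr.data M 0 M hM.le)) (hmax : 𝒟.IsMaximal)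
    (hbad : ¬ 𝒟.HasCompleteFutureNullInfinityFar ∨
      ∀ k : ℕ, ∀ 𝒟oc : Set 𝒟.carrier, ¬ 𝒟.toSpacetime.ConvergesToKerr 𝒟oc M 0 k) :
    ¬ BulkKerrCapture := by
  intro h
  obtain ⟨k, hk⟩ := bulkKerrCapture_atSchwarzschildData h hM
  obtain ⟨hfar, 𝒟oc, hconv⟩ := hk 𝒟 hmax
  rcases hbad with hfar' | hconv'
  · exact hfar' hfar
  · exact hconv' k 𝒟oc hconv

/-! ## §2b Monotonicity in the exponents and the normal form of the crux (cycle 2)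

`CaptureAt` is an UP-SET in `(s, δ)` (the data distance is monotone in `(s, δ)`,
`dataWeightedSobolevEDist_mono` of the sister file `NearExtremalKappaCapture/Negative/
ExponentMonotonicity.lean`), a DOWN-SET in `k` (`ConvergesTo.of_le`), antitone in `ε` and monotone
in `C ≥ 0`. Hence the crux is equivalent to its restriction to ANY prescribed lower bounds
`s ≥ s₀`, `δ ≥ δ₀`, to `k = 0`, `ε ≤ 1`, `C ≥ 0` (`bulkKerrCapture_iff_normalForm`), and to the
one-exponent diagonal form `s = δ = N`, `k = 0` (`bulkKerrCapture_iff_diagonal`). Consequences: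
(i) for the PROVER — take `s, δ` as large as the vendored theorem wants, `k = 0`; (ii) for the
DISPROVER — a kill must defeat EVERY `N` (`not_bulkKerrCapture_iff`), which is exactly why the
`s ≤ 1` two-body mechanism of §3c/§5(c) cannot refute the crux although it is expected to refute
the frozen member `LowRegularityCapture`. -/

/-- **Monotonicity of the capture body in all its parameters.** Larger `(s, δ)` shrink the ball and
enlarge the modulus' argument, smaller `k` weakens the convergence, smaller `ε` shrinks the ball,
larger `C ≥ 0` weakens the modulus. [folklore] -/
theorem CaptureAt.mono [Kerr.Facts] [Kerr.SliceFacts] {s s' : ℕ} {δ δ' : ℝ} {k k' : ℕ} {M : ℝ}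
    {hM : 0 ≤ M} {ε ε' C C' a : ℝ} (hs : s ≤ s') (hδ : δ ≤ δ') (hk : k' ≤ k) (hε : ε' ≤ ε)
    (hC0 : 0 ≤ C) (hC : C ≤ C') (h : CaptureAt s δ k M hM ε C a) :
    CaptureAt s' δ' k' M hM ε' C' a := by
  intro D _ hvac hdist 𝒟 hmax
  have hmono := Theorems.NearExtremalKappaCapture.Negative.dataWeightedSobolevEDist_mono hs hδ D
    (Kerr.data M a M hM)
  have hdist₀ : InitialDataSet.dataWeightedSobolevEDist s δ D (Kerr.data M a M hM) <
      ENNReal.ofReal ε :=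
    lt_of_le_of_lt hmono (hdist.trans_le (ENNReal.ofReal_le_ofReal hε))
  obtain ⟨M', a', 𝒟oc, hsub, hfar, hconv, hpar⟩ := h D hvac hdist₀ 𝒟 hmax
  refine ⟨M', a', 𝒟oc, hsub, hfar, Spacetime.ConvergesTo.of_le hconv hk, hpar.trans ?_⟩
  have hfin : InitialDataSet.dataWeightedSobolevEDist s' δ' D (Kerr.data M a M hM) ≠ ⊤ :=
    (hdist.trans_le le_top).ne
  have hle : (InitialDataSet.dataWeightedSobolevEDist s δ D (Kerr.data M a M hM)).toReal ≤
      (InitialDataSet.dataWeightedSobolevEDist s' δ' D (Kerr.data M a M hM)).toReal :=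
    ENNReal.toReal_mono hfin hmono
  calc C * √(InitialDataSet.dataWeightedSobolevEDist s δ D (Kerr.data M a M hM)).toReal
      ≤ C * √(InitialDataSet.dataWeightedSobolevEDist s' δ' D (Kerr.data M a M hM)).toReal :=
        mul_le_mul_of_nonneg_left (Real.sqrt_le_sqrt hle) hC0
    _ ≤ C' * √(InitialDataSet.dataWeightedSobolevEDist s' δ' D (Kerr.data M a M hM)).toReal :=
        mul_le_mul_of_nonneg_right hC (Real.sqrt_nonneg _)

/-- **Normal form of the crux.** `BulkKerrCapture` is equivalent to its restriction to exponents
`s ≥ s₀`, `δ ≥ δ₀` for ANY prescribed `(s₀, δ₀)`, `C⁰` convergence (`k = 0`), balls of radius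
`ε ≤ 1` and moduli with `C ≥ 0`. In particular the crux IS its own high-regularity member
(`s₀ = 2`, or `17`): the existential `s` may always be taken above the Sobolev threshold below
which (§3c) the statement is expected to fail. [folklore] -/
theorem bulkKerrCapture_iff_normalForm (s₀ : ℕ) (δ₀ : ℝ) :
    BulkKerrCapture ↔
      ∀ [Kerr.Facts] [Kerr.SliceFacts], ∀ a₁ : ℝ, a₁ < 1 → ∃ s ≥ s₀, ∃ δ ≥ δ₀,
        ∀ (M : ℝ) (hM : 0 < M), ∃ ε > (0 : ℝ), ε ≤ 1 ∧ ∃ C ≥ (0 : ℝ), ∀ a : ℝ, |a| ≤ a₁ * M →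
          CaptureAt s δ 0 M hM.le ε C a := by
  rw [bulkKerrCapture_iff]
  constructor
  · intro h _ _ a₁ ha₁
    obtain ⟨s, δ, k, hk⟩ := h a₁ ha₁
    refine ⟨max s s₀, le_max_right _ _, max δ δ₀, le_max_right _ _, fun M hM ↦ ?_⟩
    obtain ⟨ε, hε, C, hC⟩ := hk M hM
    refine ⟨min ε 1, lt_min hε one_pos, min_le_right _ _, max C 0, le_max_right _ _,
      fun a ha ↦ ?_⟩
    have h1 : CaptureAt s δ k M hM.le (min ε 1) (max C 0) a := by
      intro D _ hvac hdist 𝒟 hmax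
      obtain ⟨M', a', 𝒟oc, hsub, hfar, hconv, hpar⟩ :=
        hC a ha D hvac (hdist.trans_le (ENNReal.ofReal_le_ofReal (min_le_left _ _))) 𝒟 hmax
      exact ⟨M', a', 𝒟oc, hsub, hfar, hconv,
        hpar.trans (mul_le_mul_of_nonneg_right (le_max_left _ _) (Real.sqrt_nonneg _))⟩
    exact h1.mono (le_max_left _ _) (le_max_left _ _) (Nat.zero_le k) le_rfl (le_max_right _ _)
      le_rfl
  · intro h _ _ a₁ ha₁
    obtain ⟨s, -, δ, -, hk⟩ := h a₁ ha₁
    refine ⟨s, δ, 0, fun M hM ↦ ?_⟩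
    obtain ⟨ε, hε, -, C, -, hC⟩ := hk M hM
    exact ⟨ε, hε, C, hC⟩

/-- **Diagonal one-exponent form.** `BulkKerrCapture` iff for every `a₁ < 1` ONE natural number
`N` works as Sobolev order and decay weight at once, with `C⁰` convergence:
`∃ N, ∀ M > 0, ∃ ε C, ∀ |a| ≤ a₁M, CaptureAt N N 0 M _ ε C a`. [folklore] -/
theorem bulkKerrCapture_iff_diagonal :
    BulkKerrCapture ↔
      ∀ [Kerr.Facts] [Kerr.SliceFacts], ∀ a₁ : ℝ, a₁ < 1 → ∃ N : ℕ,
        ∀ (M : ℝ) (hM : 0 < M), ∃ ε > (0 : ℝ), ∃ C : ℝ, ∀ a : ℝ, |a| ≤ a₁ * M →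
          CaptureAt N (N : ℝ) 0 M hM.le ε C a := by
  rw [bulkKerrCapture_iff]
  constructor
  · intro h _ _ a₁ ha₁
    obtain ⟨s, δ, k, hk⟩ := h a₁ ha₁
    refine ⟨max s ⌈δ⌉₊, fun M hM ↦ ?_⟩
    obtain ⟨ε, hε, C, hC⟩ := hk M hM
    refine ⟨ε, hε, max C 0, fun a ha ↦ ?_⟩
    have hsN : s ≤ max s ⌈δ⌉₊ := le_max_left _ _
    have hδN : δ ≤ ((max s ⌈δ⌉₊ : ℕ) : ℝ) :=
      (Nat.le_ceil δ).trans (by exact_mod_cast le_max_right s ⌈δ⌉₊)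
    have h1 : CaptureAt s δ k M hM.le ε (max C 0) a := by
      intro D _ hvac hdist 𝒟 hmax
      obtain ⟨M', a', 𝒟oc, hsub, hfar, hconv, hpar⟩ := hC a ha D hvac hdist 𝒟 hmax
      exact ⟨M', a', 𝒟oc, hsub, hfar, hconv,
        hpar.trans (mul_le_mul_of_nonneg_right (le_max_left _ _) (Real.sqrt_nonneg _))⟩
    exact h1.mono hsN hδN (Nat.zero_le k) le_rfl (le_max_right _ _) le_rfl
  · intro h _ _ a₁ ha₁
    obtain ⟨N, hN⟩ := h a₁ ha₁
    exact ⟨N, N, 0, hN⟩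

/-- **What a disproof must show.** Granted the two instance facts, `¬ BulkKerrCapture` iff for
SOME `a₁ < 1` capture fails at EVERY diagonal order `N` — for each `N` some mass `M > 0` admits no
ball radius and constant at all. A mechanism living below a fixed Sobolev order (two-body data in
`H^{≤1}`, §3c) therefore never reaches the crux. [folklore] -/
theorem not_bulkKerrCapture_iff [hF : Kerr.Facts] [hS : Kerr.SliceFacts] :
    ¬ BulkKerrCapture ↔
      ∃ a₁ : ℝ, a₁ < 1 ∧ ∀ N : ℕ, ∃ (M : ℝ) (hM : 0 < M), ∀ ε > (0 : ℝ), ∀ C : ℝ,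
        ∃ a : ℝ, |a| ≤ a₁ * M ∧ ¬ CaptureAt N (N : ℝ) 0 M hM.le ε C a := by
  rw [bulkKerrCapture_iff_diagonal]
  constructor
  · intro h
    by_contra hcon
    push Not at hcon
    exact h fun {_ _} a₁ ha₁ ↦ by
      obtain ⟨N, hN⟩ := hcon a₁ ha₁
      exact ⟨N, fun M hM ↦ by
        obtain ⟨ε, hε, C, hC⟩ := hN M hM
        exact ⟨ε, hε, C, fun a ha ↦ by
          have := hC a ha
          convert this⟩⟩
  · rintro ⟨a₁, ha₁, h⟩ h'
    obtain ⟨N, hN⟩ := @h' hF hS a₁ ha₁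
    obtain ⟨M, hM, hM'⟩ := h N
    obtain ⟨ε, hε, C, hC⟩ := hN M hM
    obtain ⟨a, ha, hna⟩ := hM' ε hε C
    exact hna (hC a ha)

/-! ## §3 Load-bearing hypotheses: negative lemmas modulo the tree's named facts

Each weakened member of `BulkCaptureFamily` below is the crux with ONE side condition weakened;
each `_false_without_` theorem refutes it from the named facts `Kerr.Facts`, `Kerr.SliceFacts`, Levi-Civita existence for
the Kerr data metric, `Kerr.data_isVacuumConstraintSolution` and Choquet-Bruhat–Geroch MGHD
existence (`choquetBruhat_geroch_exists_mghd_cauchy`) — all theorems in print, none constructible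
in the tree today, which is exactly why these are negative lemmas and not refutations. -/

/-- An MGHD of the Kerr data exists, from the named facts (CBG 1969 Thm. 3 applied to
`Kerr.data M a r₀`; the slice is Hausdorff and second countable as an open subset of `E3`,
connected by `Kerr.SliceFacts`). [cite: ChoquetBruhatGeroch1969CMP, Thm. 3 (p. 332)] -/
theorem exists_mghd_kerrData [Kerr.Facts] [Kerr.SliceFacts]
    (hLC : ∀ (M a r₀ : ℝ) (hM : 0 ≤ M),
      (Kerr.data M a r₀ hM).metric.isCovariantDerivativeOn_leviCivitaFun)
    (hvac : ∀ (M a r₀ : ℝ), Kerr.data_isVacuumConstraintSolution M a r₀)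
    (hMGHD : choquetBruhat_geroch_exists_mghd_cauchy) (M a r₀ : ℝ) (hM : 0 ≤ M) :
    ∃ 𝒟 : VacuumCauchyDevelopment (Kerr.data M a r₀ hM), 𝒟.IsMaximal := by
  haveI := PseudoRiemannianMetric.HasLeviCivita.of _ (hLC M a r₀ hM)
  exact hMGHD (Kerr.slice a r₀) (Kerr.data M a r₀ hM) (hvac M a r₀ hM)

/-- **The crux family with its two side conditions exposed**: spin thresholds `a₁` range over
`T ⊆ ℝ` and masses over `{M | 0 ≤ M ∧ P M}`; everything else verbatim (`CaptureAt`). The crux is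
the member `T = Iio 1`, `P = (0 < ·)` (`bulkKerrCapture_iff_family`); the two one-hypothesis
weakenings studied below are `T = Iic 1` (closed spin range, (A)) and `P = ⊤` (`0 ≤ M`, (B)).
A parametrised predicate, not a named fact. [folklore] -/
def BulkCaptureFamily [Kerr.Facts] [Kerr.SliceFacts] (T : Set ℝ) (P : ℝ → Prop) : Prop :=
  ∀ a₁ ∈ T, ∃ (s : ℕ) (δ : ℝ) (k : ℕ), ∀ (M : ℝ) (hM : 0 ≤ M), P M → ∃ ε > (0 : ℝ), ∃ C : ℝ,
    ∀ a : ℝ, |a| ≤ a₁ * M → CaptureAt s δ k M hM ε C a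

/-- The family is antitone in the threshold set and in the mass predicate: enlarging `T` or `P`
strengthens the statement. [folklore] -/
theorem BulkCaptureFamily.anti [Kerr.Facts] [Kerr.SliceFacts] {T T' : Set ℝ} {P P' : ℝ → Prop}
    (h : BulkCaptureFamily T P) (hT : T' ⊆ T) (hP : ∀ M, P' M → P M) :
    BulkCaptureFamily T' P' := by
  intro a₁ ha₁
  obtain ⟨s, δ, k, hk⟩ := h a₁ (hT ha₁)
  exact ⟨s, δ, k, fun M hM hPM ↦ hk M hM (hP M hPM)⟩

/-- **The crux is the member `T = Iio 1`, `P = (0 < ·)` of the family.** [folklore] -/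
theorem bulkKerrCapture_iff_family :
    BulkKerrCapture ↔
      ∀ [Kerr.Facts] [Kerr.SliceFacts], BulkCaptureFamily (Iio 1) (fun M ↦ 0 < M) := by
  rw [bulkKerrCapture_iff]
  constructor
  · intro h _ _ a₁ ha₁
    obtain ⟨s, δ, k, hk⟩ := h a₁ ha₁
    exact ⟨s, δ, k, fun M _ hM ↦ hk M hM⟩
  · intro h _ _ a₁ ha₁
    obtain ⟨s, δ, k, hk⟩ := h a₁ ha₁
    exact ⟨s, δ, k, fun M hM ↦ hk M hM.le hM⟩

/-- (A) The closed-range member (`a₁ ≤ 1`, i.e. spins `|a| ≤ M` including extremality) implies the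
crux: it is a strengthening. [folklore] -/
theorem bulkKerrCapture_of_closedRange
    (h : ∀ [Kerr.Facts] [Kerr.SliceFacts], BulkCaptureFamily (Iic 1) (fun M ↦ 0 < M)) :
    BulkKerrCapture :=
  bulkKerrCapture_iff_family.2 (h.anti Iio_subset_Iic_self fun _ hM ↦ hM)

/-- (B) The `0 ≤ M` member (`P = ⊤`) implies the crux: it is a strengthening. [folklore] -/
theorem bulkKerrCapture_of_nonnegMass
    (h : ∀ [Kerr.Facts] [Kerr.SliceFacts], BulkCaptureFamily (Iio 1) fun _ ↦ True) :
    BulkKerrCapture :=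
  bulkKerrCapture_iff_family.2 (h.anti subset_rfl fun _ _ ↦ trivial)

/-- **(A) `a₁ < 1` is load-bearing (any proof must use the strict spin gap), already at the centre
of the ball.** In any instance world where the named facts hold, the closed-range member is FALSE:
at `a₁ = 1`, `M = 1`, `a = 1` the exact extremal Kerr data `Kerr.data 1 1 1` lie in every ball
around themselves, an MGHD exists (CBG), and the conclusion demands sub-extremal `(M', a')` with
`|M' − 1| + |a' − 1| ≤ C · √0 = 0`, i.e. `(M', a') = (1, 1)`, which is not sub-extremal. (The
physics agrees for a different reason — Aretakis, `Literature.Barriers.FinalStateConjecture.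
ExtremalHorizonInstability` — but the formal kill is the modulus alone.) [folklore] -/
theorem bulkCaptureFamily_false_without_spinGap [Kerr.Facts] [Kerr.SliceFacts]
    (hLC : ∀ (M a r₀ : ℝ) (hM : 0 ≤ M),
      (Kerr.data M a r₀ hM).metric.isCovariantDerivativeOn_leviCivitaFun)
    (hvac : ∀ (M a r₀ : ℝ), Kerr.data_isVacuumConstraintSolution M a r₀)
    (hMGHD : choquetBruhat_geroch_exists_mghd_cauchy) :
    ¬ BulkCaptureFamily (Iic 1) (fun M ↦ 0 < M) := by
  intro h
  obtain ⟨s, δ, k, hk⟩ := h 1 (Set.mem_Iic.2 le_rfl)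
  obtain ⟨ε, hε, C, hC⟩ := hk 1 zero_le_one one_pos
  have hspin : |(1 : ℝ)| ≤ 1 * 1 := by norm_num
  have hcap := hC 1 hspin
  obtain ⟨𝒟, hmax⟩ := exists_mghd_kerrData hLC hvac hMGHD 1 1 1 zero_le_one
  haveI := PseudoRiemannianMetric.HasLeviCivita.of _ (hLC 1 1 1 zero_le_one)
  have h0 : InitialDataSet.dataWeightedSobolevEDist s δ (Kerr.data 1 1 1 zero_le_one)
      (Kerr.data 1 1 1 zero_le_one) < ENNReal.ofReal ε := by
    rw [InitialDataSet.dataWeightedSobolevEDist_self]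
    exact ENNReal.ofReal_pos.2 hε
  obtain ⟨M', a', -, hsub, -, -, hpar⟩ := hcap _ (hvac 1 1 1 zero_le_one) h0 𝒟 hmax
  rw [InitialDataSet.dataWeightedSobolevEDist_self, ENNReal.toReal_zero, Real.sqrt_zero,
    mul_zero] at hpar
  unfold Kerr.IsSubextremal at hsub
  have h1 : |M' - 1| ≤ 0 := by linarith [abs_nonneg (a' - 1)]
  have h2 : |a' - 1| ≤ 0 := by linarith [abs_nonneg (M' - 1)]
  have hM' : M' = 1 := by linarith [abs_le.1 h1]
  have ha' : a' = 1 := by linarith [abs_le.1 h2]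
  subst hM' ha'
  norm_num at hsub

/-- **(B) `0 < M` is load-bearing.** In any instance world where the named facts hold, the `0 ≤ M`
member is FALSE: at `a₁ = 0`, `M = 0`, `a = 0` the flat punctured data `Kerr.data 0 0 0` lie in
every ball around themselves, an MGHD exists (CBG), and the conclusion demands `(M', a')`
sub-extremal with `|M'| + |a'| ≤ C · √0 = 0`, i.e. `M' = 0`, `|a'| < 0`. (Geometrically the MGHD of
flat data on `ℝ³ ∖ {0}` is `{|t| < |x⃗|} ⊂ ℝ^{1,3}`, which is indeed NOT far-complete — infalling
radial rays from radius `R` die at affine time `R/2` with sojourn `≈ R₀/2` — but the formal kill is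
again the modulus.) [folklore] -/
theorem bulkCaptureFamily_false_without_posMass [Kerr.Facts] [Kerr.SliceFacts]
    (hLC : ∀ (M a r₀ : ℝ) (hM : 0 ≤ M),
      (Kerr.data M a r₀ hM).metric.isCovariantDerivativeOn_leviCivitaFun)
    (hvac : ∀ (M a r₀ : ℝ), Kerr.data_isVacuumConstraintSolution M a r₀)
    (hMGHD : choquetBruhat_geroch_exists_mghd_cauchy) :
    ¬ BulkCaptureFamily (Iio 1) (fun _ ↦ True) := by
  intro h
  obtain ⟨s, δ, k, hk⟩ := h 0 (by norm_num)
  obtain ⟨ε, hε, C, hC⟩ := hk 0 le_rfl trivial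
  have hspin : |(0 : ℝ)| ≤ 0 * 0 := by norm_num
  have hcap := hC 0 hspin
  obtain ⟨𝒟, hmax⟩ := exists_mghd_kerrData hLC hvac hMGHD 0 0 0 le_rfl
  haveI := PseudoRiemannianMetric.HasLeviCivita.of _ (hLC 0 0 0 le_rfl)
  have h0 : InitialDataSet.dataWeightedSobolevEDist s δ (Kerr.data 0 0 0 le_rfl)
      (Kerr.data 0 0 0 le_rfl) < ENNReal.ofReal ε := by
    rw [InitialDataSet.dataWeightedSobolevEDist_self]
    exact ENNReal.ofReal_pos.2 hε
  obtain ⟨M', a', -, hsub, -, -, hpar⟩ := hcap _ (hvac 0 0 0 le_rfl) h0 𝒟 hmax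
  rw [InitialDataSet.dataWeightedSobolevEDist_self, ENNReal.toReal_zero, Real.sqrt_zero,
    mul_zero] at hpar
  unfold Kerr.IsSubextremal at hsub
  have h1 : |M' - 0| ≤ 0 := by linarith [abs_nonneg (a' - 0)]
  have hM' : M' = 0 := by linarith [abs_le.1 h1]
  subst hM'
  linarith [abs_nonneg a']

/-- **The two negative lemmas against the crux's own world.** If the crux holds together with the
named facts, then neither one-hypothesis weakening does: the spin gap and the positivity of the
mass are each used essentially. [folklore] -/
theorem strengthenings_fail [Kerr.Facts] [Kerr.SliceFacts]
    (hLC : ∀ (M a r₀ : ℝ) (hM : 0 ≤ M),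
      (Kerr.data M a r₀ hM).metric.isCovariantDerivativeOn_leviCivitaFun)
    (hvac : ∀ (M a r₀ : ℝ), Kerr.data_isVacuumConstraintSolution M a r₀)
    (hMGHD : choquetBruhat_geroch_exists_mghd_cauchy) :
    ¬ BulkCaptureFamily (Iic 1) (fun M ↦ 0 < M) ∧ ¬ BulkCaptureFamily (Iio 1) (fun _ ↦ True) :=
  ⟨bulkCaptureFamily_false_without_spinGap hLC hvac hMGHD,
    bulkCaptureFamily_false_without_posMass hLC hvac hMGHD⟩


/-! ## §3b Degenerate centres — the general form of the load-bearing lemmas (cycle 2)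

Cycle 1 refuted the two one-hypothesis weakenings `T = Iic 1` and `P = ⊤` at `M = 1`, `a = 1`
resp. `M = a = 0`, each modulo FIVE named facts. Cycle 2 sharpens this in three ways.

* The Levi-Civita hypothesis `hLC` is DISCHARGED: `PseudoRiemannianMetric.hasLeviCivita`
  (`LeviCivitaProofs`, O'Neill 1983 Thm. 3.11, proved in the tree) gives `[D.metric.HasLeviCivita]`
  for every smooth data metric, in particular for `Kerr.data M a r₀ hM`.
* ONE core lemma covers every degenerate centre: `captureAt_noMGHD_of_not_isSubextremal` — if the
  capture body holds with some `ε > 0` at a centre `Kerr.data M a M` whose own parameters are NOT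
  sub-extremal (`M ≤ |a|`: extremal `|a| = M`, super-extremal `|a| > M`, or massless `M = a = 0`),
  then that exact Kerr datum has NO maximal vacuum Cauchy development (the modulus pins
  `(M', a') = (M, a)`, which the conclusion requires to be sub-extremal). MGHD existence is thus
  needed only AT the degenerate datum, and only to contradict this.
* The COMPLETE CLASSIFICATION of the two-parameter family `BulkCaptureFamily T P`
  (`bulkCaptureFamily_classification`): modulo the named facts (constraints for Kerr data, CBG),
  every member is either (i) vacuous (`T = ∅` or no admissible mass `M ≥ 0`) and trivially true,
  (ii) `T ⊆ Iio 1 ∧ ¬ P 0` and then IMPLIED BY THE CRUX, or (iii) FALSE. So the planners' side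
  conditions `a₁ < 1`, `0 < M` are exactly the boundary of cheap (degenerate-centre)
  refutability: the crux is the envelope of the non-refuted members, and nothing further can be
  squeezed out of the quantifier prefix from this side. -/

/-- **Core degenerate-centre lemma.** If `CaptureAt s δ k M hM ε C a` holds with `ε > 0` at a
centre whose parameters are not sub-extremal (`¬ |a| < M`), then the exact Kerr datum
`Kerr.data M a M` (which lies in every ball around itself, `dist_self = 0`) has no maximal vacuum
Cauchy development: for such a `𝒟` the conclusion would give sub-extremal `(M', a')` with
`|M' − M| + |a' − a| ≤ C · √0 = 0`. Only the vacuum constraints for that one datum are assumed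
(`hvac`, named fact `Kerr.data_isVacuumConstraintSolution M a M`); the Levi-Civita instance is
`PseudoRiemannianMetric.hasLeviCivita`. [folklore] -/
theorem captureAt_noMGHD_of_not_isSubextremal [Kerr.Facts] [Kerr.SliceFacts] {s : ℕ} {δ : ℝ}
    {k : ℕ} {M : ℝ} {hM : 0 ≤ M} {ε C a : ℝ} (hε : 0 < ε) (ha : ¬ Kerr.IsSubextremal M a)
    (h : CaptureAt s δ k M hM ε C a) (hvac : Kerr.data_isVacuumConstraintSolution M a M)
    (𝒟 : VacuumCauchyDevelopment (Kerr.data M a M hM)) : ¬ 𝒟.IsMaximal := by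
  intro hmax
  haveI := (Kerr.data M a M hM).metric.hasLeviCivita
  have h0 : InitialDataSet.dataWeightedSobolevEDist s δ (Kerr.data M a M hM)
      (Kerr.data M a M hM) < ENNReal.ofReal ε := by
    rw [InitialDataSet.dataWeightedSobolevEDist_self]
    exact ENNReal.ofReal_pos.2 hε
  obtain ⟨M', a', -, hsub, -, -, hpar⟩ := h _ (hvac hM) h0 𝒟 hmax
  rw [InitialDataSet.dataWeightedSobolevEDist_self, ENNReal.toReal_zero, Real.sqrt_zero,
    mul_zero] at hpar
  have h1 : |M' - M| ≤ 0 := by linarith [abs_nonneg (a' - a)]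
  have h2 : |a' - a| ≤ 0 := by linarith [abs_nonneg (M' - M)]
  have hM' : M' = M := by linarith [abs_le.1 h1]
  have ha' : a' = a := by linarith [abs_le.1 h2]
  subst hM' ha'
  exact ha hsub

/-- The three degenerate regimes of the core lemma, spelled out: extremal (`|a| = M`),
super-extremal (`M < |a|`) and massless (`M = 0`, any `a`) centres are not sub-extremal.
[folklore] -/
theorem not_isSubextremal_of_le {M a : ℝ} (h : M ≤ |a|) : ¬ Kerr.IsSubextremal M a := by
  unfold Kerr.IsSubextremal
  exact not_lt.2 h

/-- MGHD existence for ONE Kerr datum from its constraint fact and Choquet-Bruhat–Geroch, without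
the Levi-Civita hypothesis of cycle 1 (`exists_mghd_kerrData`): the instance is
`PseudoRiemannianMetric.hasLeviCivita`. [cite: ChoquetBruhatGeroch1969CMP, Thm. 3 (p. 332)] -/
theorem exists_mghd_kerrData_of [Kerr.Facts] [Kerr.SliceFacts] {M a r₀ : ℝ}
    (hvac : Kerr.data_isVacuumConstraintSolution M a r₀)
    (hMGHD : choquetBruhat_geroch_exists_mghd_cauchy) (hM : 0 ≤ M) :
    ∃ 𝒟 : VacuumCauchyDevelopment (Kerr.data M a r₀ hM), 𝒟.IsMaximal := by
  haveI := (Kerr.data M a r₀ hM).metric.hasLeviCivita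
  exact hMGHD (Kerr.slice a r₀) (Kerr.data M a r₀ hM) (hvac hM)

/-- MGHD existence for the Schwarzschild / flat members `a = 0` modulo Choquet-Bruhat–Geroch
ALONE: their constraints are the tree theorem `Kerr.data_isVacuumConstraintSolution_zero`
(`KerrDataSchwarzschildConstraints.lean`). [cite: ChoquetBruhatGeroch1969CMP, Thm. 3 (p. 332)] -/
theorem exists_mghd_kerrData_zero [Kerr.Facts] [Kerr.SliceFacts]
    (hMGHD : choquetBruhat_geroch_exists_mghd_cauchy) (M r₀ : ℝ) (hM : 0 ≤ M) :
    ∃ 𝒟 : VacuumCauchyDevelopment (Kerr.data M 0 r₀ hM), 𝒟.IsMaximal :=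
  exists_mghd_kerrData_of (Kerr.data_isVacuumConstraintSolution_zero M r₀) hMGHD hM

/-- **(A, general form.)** Every member whose threshold set reaches `a₁ ≥ 1` and whose mass
predicate admits some `M > 0` is FALSE modulo Choquet-Bruhat–Geroch and the constraints of the
extremal slice data `Kerr.data M M M` (`hvac`; unproved in the tree for `a ≠ 0`): the extremal
centre `a = M` (`|M| ≤ a₁ M`) has an MGHD by CBG and none by
`captureAt_noMGHD_of_not_isSubextremal`. Specialises to cycle 1's
`bulkCaptureFamily_false_without_spinGap` (`T = Iic 1`, `M = 1`), now without `hLC`. [folklore] -/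
theorem bulkCaptureFamily_false_of_one_le [Kerr.Facts] [Kerr.SliceFacts] {T : Set ℝ}
    {P : ℝ → Prop} (hT : ∃ a₁ ∈ T, 1 ≤ a₁) (hP : ∃ M, 0 < M ∧ P M)
    (hvac : ∀ M : ℝ, Kerr.data_isVacuumConstraintSolution M M M)
    (hMGHD : choquetBruhat_geroch_exists_mghd_cauchy) : ¬ BulkCaptureFamily T P := by
  intro h
  obtain ⟨a₁, ha₁T, ha₁⟩ := hT
  obtain ⟨M, hM, hPM⟩ := hP
  obtain ⟨s, δ, k, hk⟩ := h a₁ ha₁T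
  obtain ⟨ε, hε, C, hC⟩ := hk M hM.le hPM
  have hspin : |M| ≤ a₁ * M := by
    rw [abs_of_pos hM]
    nlinarith
  obtain ⟨𝒟, hmax⟩ := exists_mghd_kerrData_of (hvac M) hMGHD hM.le
  exact captureAt_noMGHD_of_not_isSubextremal hε
    (not_isSubextremal_of_le (by rw [abs_of_pos hM])) (hC M hspin) (hvac M) 𝒟 hmax

/-- **(B, general form.)** Every member with nonempty threshold set whose mass predicate admits
`M = 0` is FALSE modulo Choquet-Bruhat–Geroch ALONE: the massless centre `M = a = 0` (flat
punctured data, `|0| ≤ a₁ · 0`; constraints = tree theorem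
`Kerr.data_isVacuumConstraintSolution_zero 0 0`) has an MGHD by CBG and none by the core lemma.
Specialises to cycle 1's `bulkCaptureFamily_false_without_posMass` (`T = Iio 1`, `P = ⊤`), now
without `hLC` AND without `hvac`. [folklore] -/
theorem bulkCaptureFamily_false_of_mass_zero [Kerr.Facts] [Kerr.SliceFacts] {T : Set ℝ}
    {P : ℝ → Prop} (hT : T.Nonempty) (hP : P 0)
    (hMGHD : choquetBruhat_geroch_exists_mghd_cauchy) : ¬ BulkCaptureFamily T P := by
  intro h
  obtain ⟨a₁, ha₁⟩ := hT
  obtain ⟨s, δ, k, hk⟩ := h a₁ ha₁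
  obtain ⟨ε, hε, C, hC⟩ := hk 0 le_rfl hP
  have hspin : |(0 : ℝ)| ≤ a₁ * 0 := by simp
  obtain ⟨𝒟, hmax⟩ := exists_mghd_kerrData_zero hMGHD 0 0 le_rfl
  exact captureAt_noMGHD_of_not_isSubextremal hε (not_isSubextremal_of_le (by simp))
    (hC 0 hspin) (Kerr.data_isVacuumConstraintSolution_zero 0 0) 𝒟 hmax

/-- **The crux implies every member inside the envelope** `T ⊆ Iio 1`, `¬ P 0` (masses `M ≥ 0`
with `P M` are then positive). [folklore] -/
theorem bulkCaptureFamily_of_bulkKerrCapture (h : BulkKerrCapture) [Kerr.Facts] [Kerr.SliceFacts]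
    {T : Set ℝ} {P : ℝ → Prop} (hT : T ⊆ Iio 1) (hP : ¬ P 0) : BulkCaptureFamily T P := by
  intro a₁ ha₁
  obtain ⟨s, δ, k, hk⟩ := (bulkKerrCapture_iff_family.1 h) a₁ (hT ha₁)
  refine ⟨s, δ, k, fun M hM hPM ↦ hk M hM (lt_of_le_of_ne hM ?_)⟩
  rintro rfl
  exact hP hPM

/-- Vacuous members hold trivially: empty threshold set, or no admissible mass `M ≥ 0`.
[folklore] -/
theorem bulkCaptureFamily_of_vacuous [Kerr.Facts] [Kerr.SliceFacts] {T : Set ℝ} {P : ℝ → Prop}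
    (h : T = ∅ ∨ ∀ M, 0 ≤ M → ¬ P M) : BulkCaptureFamily T P := by
  intro a₁ ha₁
  rcases h with rfl | hP
  · exact (Set.notMem_empty a₁ ha₁).elim
  · exact ⟨0, 0, 0, fun M hM hPM ↦ (hP M hM hPM).elim⟩

/-- **Classification of the family `BulkCaptureFamily T P` (cycle 2).** Modulo the named facts
(vacuum constraints of the Kerr data, Choquet-Bruhat–Geroch), every member falls in exactly one
of three explicit classes: (i) VACUOUS (`T = ∅` or no admissible mass `M ≥ 0`) — trivially true;
(ii) inside the ENVELOPE (`T ⊆ Iio 1`, `¬ P 0`) — implied by the crux; (iii) outside it — FALSE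
(by the extremal centre `a = M` if some `a₁ ≥ 1` and some `M > 0` are admissible, by the massless
centre if `P 0`). The crux `(Iio 1, (0 < ·))` is the largest member of class (ii): its two side
conditions are precisely the boundary of degenerate-centre refutability, and no further
information can be extracted from the quantifier prefix on this side. [folklore] -/
theorem bulkCaptureFamily_classification [Kerr.Facts] [Kerr.SliceFacts]
    (hvac : ∀ M : ℝ, Kerr.data_isVacuumConstraintSolution M M M)
    (hMGHD : choquetBruhat_geroch_exists_mghd_cauchy) (T : Set ℝ) (P : ℝ → Prop) :
    ((T = ∅ ∨ ∀ M, 0 ≤ M → ¬ P M) ∧ BulkCaptureFamily T P) ∨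
      ((T ⊆ Iio 1 ∧ ¬ P 0) ∧ (BulkKerrCapture → BulkCaptureFamily T P)) ∨
      ((T.Nonempty ∧ ((∃ a₁ ∈ T, 1 ≤ a₁) ∧ (∃ M, 0 < M ∧ P M) ∨ P 0)) ∧
        ¬ BulkCaptureFamily T P) := by
  by_cases hvacuous : T = ∅ ∨ ∀ M, 0 ≤ M → ¬ P M
  · exact Or.inl ⟨hvacuous, bulkCaptureFamily_of_vacuous hvacuous⟩
  push Not at hvacuous
  obtain ⟨hT, M, hM, hPM⟩ := hvacuous
  by_cases hP0 : P 0
  · exact Or.inr (Or.inr ⟨⟨hT, Or.inr hP0⟩,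
      bulkCaptureFamily_false_of_mass_zero hT hP0 hMGHD⟩)
  have hMpos : 0 < M := lt_of_le_of_ne hM (by rintro rfl; exact hP0 hPM)
  by_cases hone : ∃ a₁ ∈ T, 1 ≤ a₁
  · exact Or.inr (Or.inr ⟨⟨hT, Or.inl ⟨hone, M, hMpos, hPM⟩⟩,
      bulkCaptureFamily_false_of_one_le hone ⟨M, hMpos, hPM⟩ hvac hMGHD⟩)
  · push Not at hone
    exact Or.inr (Or.inl ⟨⟨fun a₁ ha₁ ↦ hone a₁ ha₁, hP0⟩,
      fun h ↦ bulkCaptureFamily_of_bulkKerrCapture h (fun a₁ ha₁ ↦ hone a₁ ha₁) hP0⟩)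

/-! ## §3c Two natural strengthenings EXPECTED false, not refutable from this side (cycle 2)

Both are genuine strengthenings of the crux (proved: each implies it); both are believed false
for reasons that need non-Kerr data in the ball, hence are recorded as signposts only
("do not route a proof of the crux through these"). See §5 (b), (c) for the mechanisms. -/

/-- **Uniform capture up to extremality** (the open-range member: spins `|a| < M`, ONE `(ε, C)`
for all of them). Implies the crux (`bulkKerrCapture_of_uniformToExtremality`). EXPECTED FALSE:
the basin must shrink to zero as `|a| → M` if exactly extremal Kerr horizons form from data
arbitrarily close (relative to the gap `1 − |a|/M`) to near-extremal Kerr — the third-law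
violation proved for Einstein–Maxwell–charged scalar field in spherical symmetry by Kehle–Unger
(arXiv:2211.15742, JEMS; "extremal critical collapse" arXiv:2402.10190) and conjectured by them
for Kerr in vacuum (moduli-space picture of the extremal threshold in the spherical charged
models: Angelopoulos–Kehle–Unger arXiv:2603.10378, whose uniform-in-parameters stability theorem
is uniform precisely because it ALLOWS extremal limits — the conjunct `IsSubextremal M' a'` is
what a uniform basin cannot afford near `|a| = M`). This is the physical content of the side condition
`a₁ < 1`, beyond the formal modulus kill of §3/§3b; it is exactly what the sister crux
`NearExtremalKappaCapture` quantifies with its basin `c(1 − a²/M²)^γ`. [folklore] -/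
def UniformToExtremalityCapture : Prop :=
  ∀ [Kerr.Facts] [Kerr.SliceFacts], ∃ (s : ℕ) (δ : ℝ) (k : ℕ), ∀ (M : ℝ) (hM : 0 < M),
    ∃ ε > (0 : ℝ), ∃ C : ℝ, ∀ a : ℝ, Kerr.IsSubextremal M a → CaptureAt s δ k M hM.le ε C a

/-- The open-range uniform member implies the crux (restrict to `|a| ≤ a₁ M < M`). [folklore] -/
theorem bulkKerrCapture_of_uniformToExtremality (h : UniformToExtremalityCapture) :
    BulkKerrCapture := by
  rw [bulkKerrCapture_iff]
  intro _ _ a₁ ha₁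
  obtain ⟨s, δ, k, hk⟩ := h
  refine ⟨s, δ, k, fun M hM ↦ ?_⟩
  obtain ⟨ε, hε, C, hC⟩ := hk M hM
  exact ⟨ε, hε, C, fun a ha ↦ hC a (isSubextremal_of_spin_le ha₁ hM ha)⟩

/-- **Low-regularity capture**: the crux with the Sobolev order frozen at `s ≤ 1` (here `s = 1`).
Implies the crux (`bulkKerrCapture_of_lowRegularity`). EXPECTED FALSE for every `δ`: an
`H¹_δ`-ball (indeed any `H^s_δ`-ball with `s < 3/2`, the scaling-critical order in dimension 3)
around `Kerr.data M a M` contains, for every `ε > 0`, vacuum data describing the same hole PLUS a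
second black hole of tiny mass `m` glued far out on an unbound orbit (the near-zone `H^s`-cost of
a glued hole of mass `m` is `≍ m^{3/2 − s}`, `→ 0` for `s ≤ 1` and `→ ∞` for `s ≥ 2`, its far
field costs `O(m)`; and the total far field can be matched to exact
`Kerr(M, a)` outside a compact set by Corvino–Schoen-type gluing; small-hole gluing: Hintz
arXiv:2306.07409 / 2408.06712 / 2408.06715). Its MGHD has complete `𝓘⁺` but two RECEDING holes,
and no single late Kerr–Schild chart `Ψ` can have `sup`-deviation `→ 0` on full slabs (a slab of
`Kerr.exterior M' a'` would have to be nearly isometric to a region containing or linking the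
small hole — rigidity of near-isometries). For `s ≥ 2` such data are infinitely far in `H^s_δ`,
which is why the crux (existential `s`) survives: THE REGULARITY EXPONENT `s ≥ 2` IS
LOAD-BEARING. Heuristic (two-body escape is not a theorem), hence a signpost only. [folklore] -/
def LowRegularityCapture : Prop :=
  ∀ [Kerr.Facts] [Kerr.SliceFacts], ∀ a₁ : ℝ, a₁ < 1 → ∃ (δ : ℝ) (k : ℕ),
    ∀ (M : ℝ) (hM : 0 < M), ∃ ε > (0 : ℝ), ∃ C : ℝ, ∀ a : ℝ, |a| ≤ a₁ * M →
      CaptureAt 1 δ k M hM.le ε C a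

/-- The `s = 1` member implies the crux (take `s := 1`). [folklore] -/
theorem bulkKerrCapture_of_lowRegularity (h : LowRegularityCapture) : BulkKerrCapture := by
  rw [bulkKerrCapture_iff]
  intro _ _ a₁ ha₁
  obtain ⟨δ, k, hk⟩ := h a₁ ha₁
  exact ⟨1, δ, k, hk⟩

/-! ## §4 Strengthenings that are false but not formalisable from this side (prose only)

* ALL-ORIGIN completeness (`𝒟.HasCompleteFutureNullInfinity` instead of the far form): false for
  every development of data on `Kerr.slice a r₀` — ingoing rays from origins `q` with
  `r(q) ↓ max r₀ 0` leave through the Cauchy horizon of the inner edge after arbitrarily short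
  affine time, and no compact `B₁ ⊆ {r > r₀}` contains them (`ModelData`, note before
  `kerr_hasCompleteFutureNullInfinity`; `StabilityCauchy`, `HasCompleteFutureNullInfinityFar`).
  The far-origin restriction `‖q‖ ≥ afRadius a M + 1` is load-bearing. A Lean proof needs the null
  geodesics of an MGHD — not available.
* `(ε, C)` uniform in `M` (`∃ ε C` before `∀ M`): excluded by the scaling `g ↦ λ²g`,
  `(M, a) ↦ (λM, λa)` of vacuum solutions versus the inhomogeneous weight `(1 + ‖x‖)^{2(δ+m)}` —
  needs genuinely non-Kerr members of the ball, not constructible here.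
* Linear modulus `C · dist`: stronger than anything printed (Klainerman–Szeftel (3.4.7)–(3.4.8)
  give `C ε₀` for layers of size `ε₀²`); plausible, unrefuted, unneeded.
* Dropping `𝒟.IsMaximal`: false (a thin globally hyperbolic slab around the slice is a vacuum
  Cauchy development with every ray incomplete and short), but again needs a constructed
  development.
* Dropping `D.IsVacuumConstraintSolution`: changes NOTHING (Gauss–Codazzi: data violating the
  constraints have no vacuum Cauchy development, so the `∀ 𝒟` is vacuous) — information for the
  prover: that hypothesis is never used.

-- Targets: none (no line picked yet; payload `targets = []`).
-/


/-! ## §5 Cycle-2 findings in prose (load-bearing beyond the prefix; vendoring gaps)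

(a) JUNK AUDIT, second pass (all negative — no trivial truth, no junk falsity):
  `Spacetime` carriers are Hausdorff + second countable + connected (`LorentzianMetric.lean`), so
  no non-Hausdorff "doubled point" development defeats `IsMaximal` (which is "every vacuum Cauchy
  development embeds", CBG's universal property, universe `u = 0` here — satisfiable by the MGHD);
  `IsCauchyHypersurface` uses ENDLESS timelike curves (no endpoints; `Icc`-parametrised and
  singleton segments excluded, `not_isEndlessTimelikeCurve_Icc`) — honest;
  `IsNormalisedNullRayFrom` = maximal geodesic on an open interval `∋ 0` + null + future +
  `g(γ'0, N) = −1` (constant curves, which ARE geodesics on `ℝ`, are excluded by the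
  normalisation); `sojournTime` = Lebesgue measure of `{t ∈ dom | 0 ≤ t, γ t ∈ A}`;
  `ConvergesTo` = `∃ τ₀ Ψ` late embedding with `sup`-`Cᵏ` deviation on FULL slabs `→ 0`, and with
  `𝒟oc` existential its covering clause is free (`𝒟oc := Ψ '' lateRegion`); note `Ψ` must be
  smooth on the WHOLE chart `Kerr.exterior M' a'` (all `t* ∈ ℝ`), while the MGHD of the one-ended
  slice does not contain the chart's far past (an exterior point with `t* < M − r` has its ingoing
  principal null ray leave `{r > M}` before `t* = 0`, so it is not in `D(Σ)`): at the centre the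
  late chart is therefore the inclusion PRECOMPOSED WITH A `t*`-SQUEEZE `(t*, y) ↦ (f t*, y)`,
  `f : ℝ ≅ (τ₀ − 1, ∞)`, `f = id` on `(τ₀, ∞)` (the "deformation retract along `t*`" of the
  `KerrConvergence` docstring) — harmless, deviation still `0` on every late slab;
  `dataWeightedSobolevEDist` is a NORM (not squared; `√dist` is a Hölder-½ modulus, slack for the
  prover), built from `iteratedFDeriv` of the zero/δ-extended components — honest on the open
  slice; `[D.metric.HasLeviCivita]` is now a THEOREM for every smooth metric
  (`PseudoRiemannianMetric.hasLeviCivita`), so it filters nothing.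
(b) THE SPIN GAP, physically: see `UniformToExtremalityCapture` (§3c) — third-law violation /
  extremal critical collapse (Kehle–Unger 2022, 2024; AKU 2026) is the expected substantive
  obstruction to uniformity up to `|a| = M`; the formal kill of §3/§3b only sees its shadow at
  the exactly extremal centre.
(c) THE SOBOLEV ORDER: see `LowRegularityCapture` (§3c) — `s ≥ 2` (more precisely `s > 3/2`) is
  load-bearing: below the critical order the ball contains multi-black-hole data whose receding
  developments defeat single-Kerr convergence while keeping `𝓘⁺` complete. A prover must choose
  `s ≥ 2`; a planner should know the statement's truth genuinely depends on the existential `s`.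
(d) THE SLICE POSITION `r₀ = M ≤ r₊` is load-bearing for the FAR-SOJOURN clause, already at the
  centre and already for Minkowski: for exterior-truncated data (`r₀ > r₊`, or flat data on
  `{‖y‖ > r₀}`) the MGHD is cut off by the OUTGOING null cone of the inner edge, an ingoing far
  ray from radius `R` dies on it at `r ≈ (R + r₀)/2` after entering `J⁺(B₀)` (`B₀ ⊆ {r ≤ R₀}`)
  at `r ≈ (R + R₀)/2`, so its sojourn is `≤ (R₀ − r₀)/2` uniformly in `R` and
  `HasCompleteFutureNullInfinityFar` FAILS; for `r₋ < r₀ ≤ r₊` the edge sphere is (marginally)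
  trapped, its outgoing cone moves inwards, and far rays must fall to `r < r₀` before dying
  (sojourn `≳ (R + R₀)/2 − r₊ → ∞`). The crux fixes `r₀ = M ∈ (r₋, r₊)` with the uniform collar
  `r₊ − M ≥ M√(1 − a₁²)`, so it is safe; but any re-statement moving the slice outside the
  horizon silently falsifies the far clause. (Needs null geodesics of an MGHD to formalise.)
(e) VENDORING GAP (for provers, not a falsity): Hintz arXiv:2606.28253 Thm. 13.1 (p. 318) assumes
  `γ − γ_{b₀} ∈ H_b^{∞,(E₀,3+ε₀)}`, `k − k_{b₀} ∈ H_b^{∞,(E₀+1,4+ε₀)}` — INFINITE b-regularity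
  with partial polyhomogeneity at `I⁰` — and smallness in `H_b^d` (13.1b); the crux's ball is ALL
  smooth vacuum data at `H^s_δ`-distance `< ε` for ONE finite `s`, which contains data whose
  derivatives of order `> s` oscillate/grow at infinity (e.g. tails `ε r^{−N} sin(r^p)` with
  `N > sp + δ + 3/2`) and lie outside (13.1a) for every `E₀`. Truth is not threatened (such tails
  carry vanishing energy and `k = 0` convergence is insensitive to them), but no printed or
  preprinted theorem covers the crux's data class verbatim: a finite-regularity form of Thm. 13.1
  (or a KS-type statement with `s` large) must be extracted when vendoring. Rem. 13.2 (p. 319)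
  gives base-point locality of the constants at FIXED inner radius `r = m₀` ("remains valid if we
  replace `b₀` with `b₁`, `|b₁ − b₀| < ε` … as long as `m₀ ∈ (r⁻_{b₁}, r⁺_{b₁})`"), which with
  compactness of `[−a₁M, a₁M]` is the crux's uniformity — IF "remains valid" is read with
  unchanged `(ε, d)`; the text does not say so explicitly.
(f) BARRIER CATALOGUE (`Literature/Barriers/FinalStateConjecture/`), second pass: the consequence
  form evades `NonSmoothNullInfinity*` (Kehrberger: no conformal compactification or peeling is
  asked, sup norms are unweighted, `k` existential), `PriceLawTail*` (only `→ 0`, no rate),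
  `TrappingDerivativeLoss*` (loss of derivatives is absorbed by the existential `(s, k)`, cf. the
  normal form §2b), `KerrSuperradiance` (bounded amplification, no obstruction to capture),
  `ExtremalHorizon*` (strictly sub-extremal range), while `KleinGordon*`, `HairyKerr*`,
  `KerrLinearHair*` (massive fields), `GregoryLaflamme*` (black strings), `NakedSingularity*`,
  `NullConditionFailure` (semilinear models) and `KillingExtensionObstruction` (rigidity — a
  `CaptureSuffices` matter) do not concern vacuum sub-extremal Kerr capture; the only catalogued
  result that BITES is `SlowlyRotatingKerrFrontier` (printed reach `|a| ≪ M`), which the crux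
  sits beyond by design (§2, `captureAt_of_kerrStabilityHoldsBelowNarrow_one`).
(g) NOT ATTACKABLE HERE and why (for the record): uniformity of `(ε, C)` in `M` (scaling — needs
  non-Kerr ball members); linear modulus `C·dist` (unprinted, plausible); dropping `IsMaximal`
  (thin slab developments — needs a constructed development); all-origin completeness (inner-edge
  rays — needs MGHD geodesics); `k ≥ 1` or `∀ k` (true presumably). The hypothesis
  `D.IsVacuumConstraintSolution` is logically redundant (Gauss–Codazzi; only the Hamiltonian half
  is proved in the tree, `HypersurfaceConstraints.lean`), information for the prover.

-- Targets (cycle 2): none. Cycle 3: see §6 (the skeleton's stubs S1–S4).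
-/


/-! ## §6 Targets (cycle 3): the registered stubs of line `frozen-charge-flat-modulus`

Skeleton `Cruxes/BulkKerrCapture/Lines/frozen-charge-flat-modulus.lean` (line lead gen 1,
sha `294962749d2a`, 2026-08-16T04:36Z) registers four stubs. Their statements are restated
VERBATIM below under the skeleton's own names (`LocalKerrConvergence` = S1
`stub_localKerrConvergence`, `FarCompleteNullInfinity` = S2 `stub_farCompleteNullInfinity`,
`LipschitzFinalState` = S3 `stub_lipschitzFinalState`, `SpinReflection` = S4
`stub_spinReflection`; the skeleton's namespace `…Cruxes.BulkKerrCapture.FrozenChargeFlatModulus`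
is a hyphenated crux workfile and cannot be imported). Findings (payload `targets = []`,
`stuck_stubs = []`; these are the standing targets until the lead reports stuck goals):

* **S4 is TRUE — not a target.** Audit of the definitions: `Kerr.radius a x` depends on `a`
  only through `a ^ 2` and on `x` through `E4.spatialNorm x`, `x 3`; `Kerr.scalarH` likewise;
  `Kerr.nullCovectorFun a x = (1, (r x₁ + a x₂)/(r² + a²), (r x₂ − a x₁)/(r² + a²), x₃/r)`, so
  for `R : x₂ ↦ −x₂` one has `ℓ_{−a}(x)(v) = ℓ_a(R x)(R v)`, `η(R v, R w) = η(v, w)`, hence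
  `g_{M,−a}(x)(v, w) = g_{M,a}(R x)(R v, R w)`; `Kerr.exterior`, `Kerr.rPlus`, the time function
  `x 0`, the slabs and late regions are `R`-invariant; `deviationCk` is a `sup` of operator norms
  of `iteratedFDeriv`, invariant under pre/post-composition with the linear isometry `R`. The
  lead's §5b proves the pointwise identities (`kerr_bilin_reflectY`, `reflectY_mem_exterior`);
  what remains is manifold plumbing. No asymmetry in `a` exists anywhere in `ConvergesToKerr`.
* **S2 is NECESSARY** (`farCompleteNullInfinity_of_bulkKerrCapture`: crux ⇒ S2): the spin
  window `|a/M − χ₀| < η`, `η = (1 − |χ₀|)/2`, lies in the compact spin set `|a| ≤ a₁ M`,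
  `a₁ = (1 + |χ₀|)/2 < 1` (`spin_le_of_window`). S2 carries no risk beyond the crux.
* **S1 is NECESSARY up to its `∀ k`** (`localKerrConvergence_exists_k_of_bulkKerrCapture`:
  crux ⇒ S1 with `∀ k ∃ (s, δ)` weakened to `∃ k ∃ (s, δ)`). The upgrade `∃ k ↦ ∀ k`
  (convergence in EVERY `Cᵏ` from `H^{s(k)}_{δ(k)}`-small smooth data) is S1's only content
  beyond the crux; printed for `H_b^∞`-conormal data (Hintz arXiv:2606.28253 Thm. 13.1 gives a
  full expansion), unprinted at finite `s(k)` — the G1 gap of §5(e) once per `k`.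
* **S3 at the centre of its ball is KERR-LIMIT RIGIDITY** (`lipschitzFinalState_atKerrData`,
  `lipschitzFinalState_atSchwarzschildData`): every sub-extremal Kerr limit `g_{M',a'}` in `Cᵏ`,
  `k ≥ k₀`, of every MGHD of the exact datum `Kerr.data M a M` has `M' = M ∧ |a'| = |a|`
  (`KerrLimitRigidity`). Kill template `not_lipschitzFinalState_of_wrongLimit` (one MGHD of one
  Schwarzschild datum converging in every `Cᵏ` to a Kerr exterior with `(M', a') ≠ (M, 0)`).
  Expected TRUE, but it is itself an unprinted Lorentzian near-isometry rigidity statement for the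
  tree's `ConvergesToKerr` (sup-`Cᵏ` on full ASYMPTOTICALLY FLAT slabs `{t* = τ}`; the late
  charts `Ψ|_{slab τ}` need not be equicontinuous — Lorentzian near-isometries have no
  Arzelà–Ascoli — so the proof must go through curvature invariants at image points). Counting:
  the order-2 invariants of a Ricci-flat type-D metric are `Ψ₂ = −M/(r − i a cos θ)³` (two real
  functions on the two-dimensional orbit space), which do NOT pin `(M, r, θ)` pointwise; the
  order-3 relation `(∇Ψ₂)²/(9Ψ₂²) = (1 − 2Mr/Σ)/(r − i a cos θ)²` along the image of an
  equatorial slab piece does (`M/r³ = M'/r'³` and `(1 − 2M/r)/r² = (1 − 2M'/r')/r'²` on an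
  interval force `M = M'`). So the skeleton's "for `k₀ ≥ 2`, local curvature invariants …
  determine `(M, |a|)`" should read `k₀ ≥ 3`; harmless since `k₀` is the prover's choice.
* **The absolute values in S3 are load-bearing** (certifies the lead's remark "a version with
  `|a' − a|` for all limits would be FALSE"): `lipschitzFinalStateSigned_false_of_convergent_mghd`
  — the sign-sensitive universal modulus `LipschitzFinalStateSigned` is inconsistent, at every
  ROTATING sub-extremal centre `a ≠ 0`, with S4 plus ONE maximal development of `Kerr.data M a M`
  converging to some sub-extremal Kerr in `C^{k₀}`; `lipschitzFinalStateSigned_false` derives the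
  latter from S1 + Choquet-Bruhat–Geroch + the constraint fact at `(M, a, M)`. Hence no
  universal-over-limits statement in this framework can orient the final spin: the crux's own
  `|a' − a|` is reachable only through the EXISTENTIAL choice of `(M', a')` (the skeleton's
  `exists_sign_flip`), exactly as the lead composed it.
* Read against §3–§5: no stub weakens `a₁ < 1` (every centre has `|χ₀| < 1`, windows are open),
  `0 < M`, the existential-after-centre `s`, or the inner radius `r₀ = M`; none is an instance of
  a refuted member of `BulkCaptureFamily`.
-/

/-- **S1 verbatim** (skeleton `LocalKerrConvergence`): local, modulus-free Kerr convergence in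
every `Cᵏ`, basin uniform on a spin window around each sub-extremal centre. [folklore] -/
def LocalKerrConvergence : Prop :=
  ∀ [Kerr.Facts] [Kerr.SliceFacts], ∀ χ₀ : ℝ, |χ₀| < 1 → ∀ k : ℕ, ∃ (s : ℕ) (δ : ℝ),
    ∃ η > (0 : ℝ), ∀ (M : ℝ) (hM : 0 < M), ∃ ε > (0 : ℝ), ∀ a : ℝ, |a / M - χ₀| < η → |a| < M →
      ∀ (D : InitialDataSet 𝓘(ℝ, E3) (Kerr.slice a M)) [D.metric.HasLeviCivita],
        D.IsVacuumConstraintSolution →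
        InitialDataSet.dataWeightedSobolevEDist s δ D (Kerr.data M a M hM.le) <
          ENNReal.ofReal ε →
        ∀ 𝒟 : VacuumCauchyDevelopment D, 𝒟.IsMaximal →
          ∃ (M' a' : ℝ) (𝒟oc : Set 𝒟.carrier), Kerr.IsSubextremal M' a' ∧
            𝒟.toSpacetime.ConvergesToKerr 𝒟oc M' a' k

/-- **S2 verbatim** (skeleton `FarCompleteNullInfinity`): far-complete `𝓘⁺` of every MGHD on a
local ball, basin uniform on a spin window. [folklore] -/
def FarCompleteNullInfinity : Prop :=
  ∀ [Kerr.Facts] [Kerr.SliceFacts], ∀ χ₀ : ℝ, |χ₀| < 1 → ∃ (s : ℕ) (δ : ℝ),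
    ∃ η > (0 : ℝ), ∀ (M : ℝ) (hM : 0 < M), ∃ ε > (0 : ℝ), ∀ a : ℝ, |a / M - χ₀| < η → |a| < M →
      ∀ (D : InitialDataSet 𝓘(ℝ, E3) (Kerr.slice a M)) [D.metric.HasLeviCivita],
        D.IsVacuumConstraintSolution →
        InitialDataSet.dataWeightedSobolevEDist s δ D (Kerr.data M a M hM.le) <
          ENNReal.ofReal ε →
        ∀ 𝒟 : VacuumCauchyDevelopment D, 𝒟.IsMaximal → 𝒟.HasCompleteFutureNullInfinityFar

/-- **S3 verbatim** (skeleton `LipschitzFinalState`, the line's lever): Lipschitz dependence of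
`(M', |a'|)` on the data for EVERY sub-extremal `Cᵏ`-Kerr limit, `k ≥ k₀`, of every MGHD of
every datum in a local ball. [folklore] -/
def LipschitzFinalState : Prop :=
  ∀ [Kerr.Facts] [Kerr.SliceFacts], ∀ χ₀ : ℝ, |χ₀| < 1 → ∃ (s : ℕ) (δ : ℝ) (k₀ : ℕ),
    ∃ η > (0 : ℝ), ∀ (M : ℝ) (hM : 0 < M), ∃ ε > (0 : ℝ), ∃ L : ℝ, ∀ a : ℝ, |a / M - χ₀| < η →
      |a| < M →
      ∀ (D : InitialDataSet 𝓘(ℝ, E3) (Kerr.slice a M)) [D.metric.HasLeviCivita],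
        D.IsVacuumConstraintSolution →
        InitialDataSet.dataWeightedSobolevEDist s δ D (Kerr.data M a M hM.le) <
          ENNReal.ofReal ε →
        ∀ 𝒟 : VacuumCauchyDevelopment D, 𝒟.IsMaximal →
          ∀ (M' a' : ℝ) (𝒟oc : Set 𝒟.carrier) (k : ℕ), k₀ ≤ k → Kerr.IsSubextremal M' a' →
            𝒟.toSpacetime.ConvergesToKerr 𝒟oc M' a' k →
            |M' - M| + abs (|a'| - |a|) ≤
              L * (InitialDataSet.dataWeightedSobolevEDist s δ D (Kerr.data M a M hM.le)).toReal

/-- **S4 verbatim** (skeleton `SpinReflection`): `ConvergesToKerr` is blind to the orientation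
of the spin. TRUE for the tree's Kerr–Schild definitions (§6 docblock). [folklore] -/
def SpinReflection : Prop :=
  ∀ (𝓢 : Spacetime.{0} 4) (𝒟 : Set 𝓢.carrier) (M a : ℝ) (k : ℕ),
    𝓢.ConvergesToKerr 𝒟 M a k → 𝓢.ConvergesToKerr 𝒟 M (-a) k

/-- A spin window `|a/M − χ₀| < (1 − |χ₀|)/2` lies in the compact spin set `|a| ≤ a₁ M` with
`a₁ = (1 + |χ₀|)/2`. [folklore] -/
theorem spin_le_of_window {χ₀ M a : ℝ} (hM : 0 < M) (h : |a / M - χ₀| < (1 - |χ₀|) / 2) :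
    |a| ≤ (1 + |χ₀|) / 2 * M := by
  have h1 : |a / M| ≤ |a / M - χ₀| + |χ₀| := by
    calc |a / M| = |(a / M - χ₀) + χ₀| := by rw [sub_add_cancel]
      _ ≤ |a / M - χ₀| + |χ₀| := abs_add_le _ _
  have h2 : |a / M| < (1 + |χ₀|) / 2 := by linarith
  rw [abs_div, abs_of_pos hM, div_lt_iff₀ hM] at h2
  exact h2.le

/-- **S2 is necessary: the crux implies `FarCompleteNullInfinity`.** Given `|χ₀| < 1` take
`a₁ := (1 + |χ₀|)/2 < 1` in the crux and `η := (1 − |χ₀|)/2`; the far-completeness conjunct of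
`CaptureAt` on the compact spin set covers the window. [folklore] -/
theorem farCompleteNullInfinity_of_bulkKerrCapture (h : BulkKerrCapture) :
    FarCompleteNullInfinity := by
  intro _ _ χ₀ hχ₀
  have ha₁ : (1 + |χ₀|) / 2 < 1 := by linarith
  obtain ⟨s, δ, k, hk⟩ := (bulkKerrCapture_iff.1 h) ((1 + |χ₀|) / 2) ha₁
  refine ⟨s, δ, (1 - |χ₀|) / 2, by linarith, fun M hM ↦ ?_⟩
  obtain ⟨ε, hε, C, hC⟩ := hk M hM
  refine ⟨ε, hε, fun a ha _ D _ hvac hdist 𝒟 hmax ↦ ?_⟩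
  obtain ⟨-, -, -, -, hfar, -, -⟩ := hC a (spin_le_of_window hM ha) D hvac hdist 𝒟 hmax
  exact hfar

/-- **S1 is necessary up to `∀ k`: the crux implies `LocalKerrConvergence` with `∃ k` in place
of `∀ k`.** Same window-in-compact-set argument; the `Cᵏ`-convergence conjunct of `CaptureAt`
at the crux's own `k`. The upgrade to every `k` is the stub's only extra content. [folklore] -/
theorem localKerrConvergence_exists_k_of_bulkKerrCapture (h : BulkKerrCapture) [Kerr.Facts]
    [Kerr.SliceFacts] {χ₀ : ℝ} (hχ₀ : |χ₀| < 1) :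
    ∃ (k s : ℕ) (δ : ℝ), ∃ η > (0 : ℝ), ∀ (M : ℝ) (hM : 0 < M), ∃ ε > (0 : ℝ), ∀ a : ℝ,
      |a / M - χ₀| < η → |a| < M →
      ∀ (D : InitialDataSet 𝓘(ℝ, E3) (Kerr.slice a M)) [D.metric.HasLeviCivita],
        D.IsVacuumConstraintSolution →
        InitialDataSet.dataWeightedSobolevEDist s δ D (Kerr.data M a M hM.le) <
          ENNReal.ofReal ε →
        ∀ 𝒟 : VacuumCauchyDevelopment D, 𝒟.IsMaximal →
          ∃ (M' a' : ℝ) (𝒟oc : Set 𝒟.carrier), Kerr.IsSubextremal M' a' ∧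
            𝒟.toSpacetime.ConvergesToKerr 𝒟oc M' a' k := by
  have ha₁ : (1 + |χ₀|) / 2 < 1 := by linarith
  obtain ⟨s, δ, k, hk⟩ := (bulkKerrCapture_iff.1 h) ((1 + |χ₀|) / 2) ha₁
  refine ⟨k, s, δ, (1 - |χ₀|) / 2, by linarith, fun M hM ↦ ?_⟩
  obtain ⟨ε, hε, C, hC⟩ := hk M hM
  refine ⟨ε, hε, fun a ha _ D _ hvac hdist 𝒟 hmax ↦ ?_⟩
  obtain ⟨M', a', 𝒟oc, hsub, -, hconv, -⟩ := hC a (spin_le_of_window hM ha) D hvac hdist 𝒟 hmax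
  exact ⟨M', a', 𝒟oc, hsub, hconv⟩

/-- **Kerr-limit rigidity at order `k₀`** for the exact datum `Kerr.data M a M`: every
sub-extremal Kerr exterior `g_{M',a'}` to which some region of some MGHD of the datum converges
in `Cᵏ`, `k ≥ k₀`, has `M' = M` and `|a'| = |a|`. The content of S3 at the centre of its ball;
an unprinted near-isometry rigidity statement for the tree's `ConvergesToKerr` (§6 docblock).
[folklore] -/
def KerrLimitRigidity [Kerr.Facts] [Kerr.SliceFacts] (k₀ : ℕ) (M : ℝ) (hM : 0 ≤ M) (a : ℝ) :
    Prop :=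
  ∀ 𝒟 : VacuumCauchyDevelopment (Kerr.data M a M hM), 𝒟.IsMaximal →
    ∀ (M' a' : ℝ) (𝒟oc : Set 𝒟.carrier) (k : ℕ), k₀ ≤ k → Kerr.IsSubextremal M' a' →
      𝒟.toSpacetime.ConvergesToKerr 𝒟oc M' a' k → M' = M ∧ |a'| = |a|

/-- **S3 at the centre of its ball is Kerr-limit rigidity** (modulo the constraint fact of the
one datum `Kerr.data M a M`): at `D = Kerr.data M a M` the distance is `0`, so the Lipschitz
bound pins `(M', |a'|) = (M, |a|)` for EVERY admissible limit. [folklore] -/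
theorem lipschitzFinalState_atKerrData (h : LipschitzFinalState) [Kerr.Facts] [Kerr.SliceFacts]
    {M a : ℝ} (hM : 0 < M) (ha : Kerr.IsSubextremal M a)
    (hvac : Kerr.data_isVacuumConstraintSolution M a M) :
    ∃ k₀ : ℕ, KerrLimitRigidity k₀ M hM.le a := by
  have hχ₀ : |a / M| < 1 := by
    rw [abs_div, abs_of_pos hM, div_lt_one hM]
    exact ha
  obtain ⟨s, δ, k₀, η, hη, hk⟩ := h (a / M) hχ₀
  obtain ⟨ε, hε, L, hL⟩ := hk M hM
  refine ⟨k₀, fun 𝒟 hmax M' a' 𝒟oc k hk₀ hsub hconv ↦ ?_⟩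
  haveI := (Kerr.data M a M hM.le).metric.hasLeviCivita
  have h0 : InitialDataSet.dataWeightedSobolevEDist s δ (Kerr.data M a M hM.le)
      (Kerr.data M a M hM.le) < ENNReal.ofReal ε := by
    rw [InitialDataSet.dataWeightedSobolevEDist_self]
    exact ENNReal.ofReal_pos.2 hε
  have hwin : |a / M - a / M| < η := by
    rw [sub_self, abs_zero]
    exact hη
  have hmod := hL a hwin ha _ (hvac hM.le) h0 𝒟 hmax M' a' 𝒟oc k hk₀ hsub hconv
  rw [InitialDataSet.dataWeightedSobolevEDist_self, ENNReal.toReal_zero, mul_zero] at hmod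
  have h1 : |M' - M| ≤ 0 := by linarith [abs_nonneg (|a'| - |a|)]
  have h2 : abs (|a'| - |a|) ≤ 0 := by linarith [abs_nonneg (M' - M)]
  exact ⟨by linarith [abs_le.1 h1], by linarith [abs_le.1 h2]⟩

/-- **S3 at the Schwarzschild centre — no named-fact hypothesis** (the `a = 0` constraints are
the tree theorem `Kerr.data_isVacuumConstraintSolution_zero`). [folklore] -/
theorem lipschitzFinalState_atSchwarzschildData (h : LipschitzFinalState) [Kerr.Facts]
    [Kerr.SliceFacts] {M : ℝ} (hM : 0 < M) : ∃ k₀ : ℕ, KerrLimitRigidity k₀ M hM.le 0 :=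
  lipschitzFinalState_atKerrData h hM (by unfold Kerr.IsSubextremal; simpa using hM)
    (Kerr.data_isVacuumConstraintSolution_zero M M)

/-- **Kill template for S3**: ONE maximal vacuum Cauchy development of ONE Schwarzschild slice
datum `Kerr.data M 0 M` with a region converging in every `Cᵏ` to a sub-extremal Kerr exterior
`g_{M',a'}`, `(M', a') ≠ (M, 0)`, refutes `LipschitzFinalState` given the instances. Expected
impossible (Kerr-limit rigidity); the precise residual obligation. [folklore] -/
theorem not_lipschitzFinalState_of_wrongLimit [Kerr.Facts] [Kerr.SliceFacts] {M : ℝ}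
    (hM : 0 < M) (𝒟 : VacuumCauchyDevelopment (Kerr.data M 0 M hM.le)) (hmax : 𝒟.IsMaximal)
    {M' a' : ℝ} (hsub : Kerr.IsSubextremal M' a') (hne : M' ≠ M ∨ a' ≠ 0)
    (hconv : ∀ k : ℕ, ∃ 𝒟oc : Set 𝒟.carrier, 𝒟.toSpacetime.ConvergesToKerr 𝒟oc M' a' k) :
    ¬ LipschitzFinalState := by
  intro h
  obtain ⟨k₀, hk₀⟩ := lipschitzFinalState_atSchwarzschildData h hM
  obtain ⟨𝒟oc, hc⟩ := hconv k₀
  obtain ⟨hM', ha'⟩ := hk₀ 𝒟 hmax M' a' 𝒟oc k₀ le_rfl hsub hc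
  rcases hne with h1 | h1
  · exact h1 hM'
  · exact h1 (by simpa using ha')

/-- **The sign-sensitive universal modulus** — S3 with `|a' − a|` in place of `||a'| − |a||`:
the natural strengthening one would write first. FALSE at every rotating centre given S4
(`lipschitzFinalStateSigned_false_of_convergent_mghd`). [folklore] -/
def LipschitzFinalStateSigned : Prop :=
  ∀ [Kerr.Facts] [Kerr.SliceFacts], ∀ χ₀ : ℝ, |χ₀| < 1 → ∃ (s : ℕ) (δ : ℝ) (k₀ : ℕ),
    ∃ η > (0 : ℝ), ∀ (M : ℝ) (hM : 0 < M), ∃ ε > (0 : ℝ), ∃ L : ℝ, ∀ a : ℝ, |a / M - χ₀| < η →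
      |a| < M →
      ∀ (D : InitialDataSet 𝓘(ℝ, E3) (Kerr.slice a M)) [D.metric.HasLeviCivita],
        D.IsVacuumConstraintSolution →
        InitialDataSet.dataWeightedSobolevEDist s δ D (Kerr.data M a M hM.le) <
          ENNReal.ofReal ε →
        ∀ 𝒟 : VacuumCauchyDevelopment D, 𝒟.IsMaximal →
          ∀ (M' a' : ℝ) (𝒟oc : Set 𝒟.carrier) (k : ℕ), k₀ ≤ k → Kerr.IsSubextremal M' a' →
            𝒟.toSpacetime.ConvergesToKerr 𝒟oc M' a' k →
            |M' - M| + |a' - a| ≤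
              L * (InitialDataSet.dataWeightedSobolevEDist s δ D (Kerr.data M a M hM.le)).toReal

/-- The signed modulus at the centre pins the SIGNED spin of every admissible limit.
[folklore] -/
theorem lipschitzFinalStateSigned_atKerrData (h : LipschitzFinalStateSigned) [Kerr.Facts]
    [Kerr.SliceFacts] {M a : ℝ} (hM : 0 < M) (ha : Kerr.IsSubextremal M a)
    (hvac : Kerr.data_isVacuumConstraintSolution M a M) :
    ∃ k₀ : ℕ, ∀ 𝒟 : VacuumCauchyDevelopment (Kerr.data M a M hM.le), 𝒟.IsMaximal →
      ∀ (M' a' : ℝ) (𝒟oc : Set 𝒟.carrier) (k : ℕ), k₀ ≤ k → Kerr.IsSubextremal M' a' →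
        𝒟.toSpacetime.ConvergesToKerr 𝒟oc M' a' k → M' = M ∧ a' = a := by
  have hχ₀ : |a / M| < 1 := by
    rw [abs_div, abs_of_pos hM, div_lt_one hM]
    exact ha
  obtain ⟨s, δ, k₀, η, hη, hk⟩ := h (a / M) hχ₀
  obtain ⟨ε, hε, L, hL⟩ := hk M hM
  refine ⟨k₀, fun 𝒟 hmax M' a' 𝒟oc k hk₀ hsub hconv ↦ ?_⟩
  haveI := (Kerr.data M a M hM.le).metric.hasLeviCivita
  have h0 : InitialDataSet.dataWeightedSobolevEDist s δ (Kerr.data M a M hM.le)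
      (Kerr.data M a M hM.le) < ENNReal.ofReal ε := by
    rw [InitialDataSet.dataWeightedSobolevEDist_self]
    exact ENNReal.ofReal_pos.2 hε
  have hwin : |a / M - a / M| < η := by
    rw [sub_self, abs_zero]
    exact hη
  have hmod := hL a hwin ha _ (hvac hM.le) h0 𝒟 hmax M' a' 𝒟oc k hk₀ hsub hconv
  rw [InitialDataSet.dataWeightedSobolevEDist_self, ENNReal.toReal_zero, mul_zero] at hmod
  have h1 : |M' - M| ≤ 0 := by linarith [abs_nonneg (a' - a)]
  have h2 : |a' - a| ≤ 0 := by linarith [abs_nonneg (M' - M)]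
  exact ⟨by linarith [abs_le.1 h1], by linarith [abs_le.1 h2]⟩

/-- Sub-extremality is blind to the sign of the spin. [folklore] -/
theorem isSubextremal_neg {M a : ℝ} (h : Kerr.IsSubextremal M a) : Kerr.IsSubextremal M (-a) := by
  unfold Kerr.IsSubextremal at h ⊢
  rwa [abs_neg]

/-- **The absolute values in S3 are load-bearing (core form).** Given spin reflection (S4), the
sign-sensitive universal modulus is FALSE at every rotating sub-extremal centre `a ≠ 0` as soon
as ONE maximal development of `Kerr.data M a M` converges in `C^{k}` (every `k`) to SOME
sub-extremal Kerr exterior: that development converges to `g_{M',a'}` and (S4) to `g_{M',−a'}`,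
and the signed modulus at distance `0` forces `a' = a` and `−a' = a`. [folklore] -/
theorem lipschitzFinalStateSigned_false_of_convergent_mghd (h4 : SpinReflection) [Kerr.Facts]
    [Kerr.SliceFacts] {M a : ℝ} (hM : 0 < M) (ha : Kerr.IsSubextremal M a) (ha0 : a ≠ 0)
    (hvac : Kerr.data_isVacuumConstraintSolution M a M)
    (hconv : ∀ k : ℕ, ∃ 𝒟 : VacuumCauchyDevelopment (Kerr.data M a M hM.le), 𝒟.IsMaximal ∧
      ∃ (M' a' : ℝ) (𝒟oc : Set 𝒟.carrier), Kerr.IsSubextremal M' a' ∧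
        𝒟.toSpacetime.ConvergesToKerr 𝒟oc M' a' k) :
    ¬ LipschitzFinalStateSigned := by
  intro h
  obtain ⟨k₀, hk₀⟩ := lipschitzFinalStateSigned_atKerrData h hM ha hvac
  obtain ⟨𝒟, hmax, M', a', 𝒟oc, hsub, hc⟩ := hconv k₀
  have hc' : 𝒟.toSpacetime.ConvergesToKerr 𝒟oc M' (-a') k₀ := h4 𝒟.toSpacetime 𝒟oc M' a' k₀ hc
  obtain ⟨-, h1⟩ := hk₀ 𝒟 hmax M' a' 𝒟oc k₀ le_rfl hsub hc
  obtain ⟨-, h2⟩ := hk₀ 𝒟 hmax M' (-a') 𝒟oc k₀ le_rfl (isSubextremal_neg hsub) hc'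
  exact ha0 (by linarith)

/-- **The absolute values in S3 are load-bearing**, from the line's own stubs: S4 and S1 (which
supplies the convergent limit at the centre) together with Choquet-Bruhat–Geroch (an MGHD of the
centre datum) and the constraint fact at `(M, a, M)` refute the signed modulus at every rotating
sub-extremal centre. [folklore] -/
theorem lipschitzFinalStateSigned_false (h4 : SpinReflection) (h1 : LocalKerrConvergence)
    (hMGHD : choquetBruhat_geroch_exists_mghd_cauchy) [Kerr.Facts] [Kerr.SliceFacts] {M a : ℝ}
    (hM : 0 < M) (ha : Kerr.IsSubextremal M a) (ha0 : a ≠ 0)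
    (hvac : Kerr.data_isVacuumConstraintSolution M a M) : ¬ LipschitzFinalStateSigned := by
  refine lipschitzFinalStateSigned_false_of_convergent_mghd h4 hM ha ha0 hvac fun k ↦ ?_
  have hχ₀ : |a / M| < 1 := by
    rw [abs_div, abs_of_pos hM, div_lt_one hM]
    exact ha
  obtain ⟨s, δ, η, hη, hk⟩ := h1 (a / M) hχ₀ k
  obtain ⟨ε, hε, hε'⟩ := hk M hM
  obtain ⟨𝒟, hmax⟩ := exists_mghd_kerrData_of hvac hMGHD hM.le
  haveI := (Kerr.data M a M hM.le).metric.hasLeviCivita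
  have h0 : InitialDataSet.dataWeightedSobolevEDist s δ (Kerr.data M a M hM.le)
      (Kerr.data M a M hM.le) < ENNReal.ofReal ε := by
    rw [InitialDataSet.dataWeightedSobolevEDist_self]
    exact ENNReal.ofReal_pos.2 hε
  have hwin : |a / M - a / M| < η := by
    rw [sub_self, abs_zero]
    exact hη
  obtain ⟨M', a', 𝒟oc, hsub, hc⟩ := hε' a hwin ha _ (hvac hM.le) h0 𝒟 hmax
  exact ⟨𝒟, hmax, M', a', 𝒟oc, hsub, hc⟩

/-! ## §7 The instance classes are theorems now (cycle 3): instance-free forms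

Since cycle 2 the tree has discharged BOTH instance hypotheses of the crux: `Kerr.Facts`
(`Kerr.isConnected_region_holds`, `Kerr.contMDiff_bilin_holds`, `Kerr.contMDiff_timeVector_holds`,
assembled below as `kerrFacts`; cf. `Theorems.SwallowTheDatum.kerrFacts`) and `Kerr.SliceFacts`
(`Kerr.sliceFacts_holds`, `Literature/Geometry/Lorentzian/KerrSliceFacts.lean`). Consequences.
(i) The crux is equivalent to its body with the instances SUPPLIED (`bulkKerrCapture_iff_body`):
the cycle-1 worry "trivial truth through an uninhabited instance class" is closed for good, and
dually the `∀ [Kerr.Facts] [Kerr.SliceFacts]` prefix costs a refuter nothing any more.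
(ii) Every negative lemma of §3/§3b holds with the instances supplied, i.e. modulo
Choquet-Bruhat–Geroch (+ the constraint fact of the extremal slice data for (A)) ALONE:
`not_nonnegMass_family` is `CBG → ¬(0 ≤ M member)` — ONE named fact away from an unconditional
refutation of that strengthening — and `not_closedRange_family` is `constraints(M, M, M) → CBG →
¬(a₁ ≤ 1 member)`. (iii) The residual obligation of an unconditional kill of the CRUX is unchanged
in kind but smaller: one maximal vacuum Cauchy development (CBG at one datum of the ball) whose
conclusion fails (`not_bulkKerrCapture_of_schwarzschild_mghd`, §2a, now needs no instance
hypotheses either: `not_bulkKerrCapture_of_schwarzschild_mghd'`). -/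

/-- `Kerr.Facts` holds (all three fields are tree theorems). [folklore] -/
theorem kerrFacts : Kerr.Facts :=
  ⟨Kerr.isConnected_region_holds, Kerr.contMDiff_bilin_holds, Kerr.contMDiff_timeVector_holds⟩

/-- **The crux is its own body at the canonical instances.** [folklore] -/
theorem bulkKerrCapture_iff_body :
    BulkKerrCapture ↔
      ∀ a₁ : ℝ, a₁ < 1 → ∃ (s : ℕ) (δ : ℝ) (k : ℕ), ∀ (M : ℝ) (hM : 0 < M), ∃ ε > (0 : ℝ),
        ∃ C : ℝ, ∀ a : ℝ, |a| ≤ a₁ * M →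
          @CaptureAt kerrFacts Kerr.sliceFacts_holds s δ k M hM.le ε C a := by
  rw [bulkKerrCapture_iff]
  exact ⟨fun h ↦ @h kerrFacts Kerr.sliceFacts_holds, fun h _ _ ↦ h⟩

/-- **(B) instance-free:** modulo Choquet-Bruhat–Geroch ALONE, the `0 ≤ M` member of the crux
family is false. [folklore] -/
theorem not_nonnegMass_family (hMGHD : choquetBruhat_geroch_exists_mghd_cauchy) :
    ¬ ∀ [Kerr.Facts] [Kerr.SliceFacts], BulkCaptureFamily (Iio 1) fun _ ↦ True := by
  intro h
  haveI := kerrFacts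
  haveI := Kerr.sliceFacts_holds
  exact bulkCaptureFamily_false_of_mass_zero ⟨0, by norm_num⟩ trivial hMGHD h

/-- **(A) instance-free:** modulo the constraints of the extremal slice data `Kerr.data M M M`
and Choquet-Bruhat–Geroch, the closed-range member `a₁ ≤ 1` is false. [folklore] -/
theorem not_closedRange_family
    (hvac : ∀ [Kerr.Facts] [Kerr.SliceFacts] (M : ℝ), Kerr.data_isVacuumConstraintSolution M M M)
    (hMGHD : choquetBruhat_geroch_exists_mghd_cauchy) :
    ¬ ∀ [Kerr.Facts] [Kerr.SliceFacts], BulkCaptureFamily (Iic 1) fun M ↦ 0 < M := by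
  intro h
  haveI := kerrFacts
  haveI := Kerr.sliceFacts_holds
  exact bulkCaptureFamily_false_of_one_le ⟨1, Set.mem_Iic.2 le_rfl, le_rfl⟩ ⟨1, one_pos, one_pos⟩
    (fun M ↦ hvac M) hMGHD h

/-- **Kill template for the crux, instance-free** (cycle-2 `not_bulkKerrCapture_of_schwarzschild_mghd`
at the canonical instances): ONE maximal vacuum Cauchy development of ONE Schwarzschild slice
datum that is not far-complete, or has no `Cᵏ`-converging late Kerr–Schild chart for any `k`,
refutes `BulkKerrCapture` OUTRIGHT. The only named fact between this file and an unconditional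
verdict is now Choquet-Bruhat–Geroch — and a bad development, which is not expected to exist.
[folklore] -/
theorem not_bulkKerrCapture_of_schwarzschild_mghd' {M : ℝ} (hM : 0 < M) :
    haveI := kerrFacts
    haveI := Kerr.sliceFacts_holds
    ∀ 𝒟 : VacuumCauchyDevelopment (Kerr.data M 0 M hM.le), 𝒟.IsMaximal →
      (¬ 𝒟.HasCompleteFutureNullInfinityFar ∨
        ∀ k : ℕ, ∀ 𝒟oc : Set 𝒟.carrier, ¬ 𝒟.toSpacetime.ConvergesToKerr 𝒟oc M 0 k) →
      ¬ BulkKerrCapture := by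
  intro 𝒟 hmax hbad
  haveI := kerrFacts
  haveI := Kerr.sliceFacts_holds
  exact not_bulkKerrCapture_of_schwarzschild_mghd hM 𝒟 hmax hbad

end Summit.FinalStateConjecture.FinalStateConjecture.Cruxes.BulkKerrCapture.Disproof

end
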